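import Literature.Computability.Complexity.Transducers
import Mathlib.Tactic.DeriveFintype
import Mathlib.Computability.Encoding
import Mathlib.Tactic.Linarith
import HarnessLib

/-!
# Exhaustive search for k-SAT on `TM2`, I: the round transducer and the search invariant

Trunk `CplxCore` / family `fine-grained`. This file and its sequel
(`ExhaustiveSatMachine.lean`) construct, once and for all, a time-bounded multi-stack Turing
machine (`Turing.FinTM2`) deciding satisfiability of CNF formulas by exhaustive search over the
assignments of the occurring variables, in time `2^d · poly(L)` (`d` = number of distinct
variables occurring, `L` = input length). This is the folklore upper bound
"k-SAT ∈ TIME(2^n · poly(L))" (Impagliazzo–Paturi 2001, §1, where it is implicit in the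
definition of `s_k` as an infimum over a set containing `1`; Lokshtanov–Marx–Saurabh 2011, §2:
"it is trivial to solve 3-CNF-Sat in time `2^n (n+m)^{O(1)}`"), which the statement file
`FineGrainedWave0.lean` records as the named fact `kSATInExpTime_one` and which makes the set
defining `satExponent k` nonempty (needed for `eth_iff_satExponent_pos`).

No Turing machine is written by hand. The search is organised as the iteration of a single
*finite-state transduction* `F = roundFST.eval` (a "round") on a *loop string* over the
24-letter alphabet `Sym`; `Transducers.lean` turns `roundFST` into a linear-time `FinTM2`, and
the clocked-iteration combinator of `TM2Iterate.lean` runs the rounds (assembled in the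
sequel). A round moves information only rightwards along the string, which dictates the
layout and the algorithm:

* **Layout.** The loop string is `hdr m :: segments ++ [stop]` (`plainStrF`), one *segment*
  `seg cur body cpy1 cpy2` (`segStrF`) per partial assignment under consideration; a *body*
  (`Body`, `bodyStr`) is the clause list, each clause `bar cell … cell`, each literal a *cell*
  `lit st pol :: bits ++ [flg ne]` (`Cell`, `cellStr`): its status `st` (unassigned `u`, pivot
  `p`, assigned `a v`), polarity, the binary code (`Computability.encodeNat`) of its variable
  with per-bit marks, and a trailing "differs from the pivot" flag.
* **Modes** (`Mode`, dispatched on the header by `step`): `cmp` — compare the next unmarked bit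
  of the pivot variable with the next unmarked bit of every unassigned cell, recording a
  mismatch in the cell's flag (`F_cmp`; after `|encodeNat x|` rounds and one exhaustion round
  every unassigned cell knows whether its variable *is* the pivot variable `x`:
  `F_cmp_adv`, `F_cmp_exh`); `copy` — copy every segment symbol by symbol (one symbol per
  round, carried in the finite state, `F_copy_lt`, `F_copy_ge`) into two fresh copies in
  which the pivot variable is assigned `false` resp. `true` (`corr`, `corrStr_bodyStr`);
  `fin` — delete the originals, promote the copies to segments and pick the first unassigned
  literal as the new pivot (`F_fin`, `pickRun_bodyStr`); `done` — identity (`F_done`).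
* **Canonical bodies** (`canon ρ cs`, threaded constructors `cellG`/`cellsG`/`bodyG`): the body
  of the clause list `cs` under the partial assignment `ρ` at the start of a pivot cycle;
  `bodyJ`, `bodyX` are the intermediate bodies inside a cycle.
* **`cycle`**: one pivot cycle takes `|encodeNat x| + litsLen cs + 3` rounds and replaces the
  segments of the assignments `ρs` by those of `ρ[x ↦ false], ρ[x ↦ true]` (`ρ ∈ ρs`), with an
  explicit bound on all intermediate lengths; **`search`**: by induction on the number `d ≥ 1`
  of unassigned occurring variables, after `R ≤ d (2 litsLen cs + 3)` rounds the string is the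
  `done` layout of `2^d |ρs|` segments whose assignments are total on the occurring variables
  and *cover* every total assignment (`Cov`), all intermediate strings having length
  `≤ 2 + 2^d |ρs| (3 litsLen cs + 4)`.

Design note: the per-round cost is linear in the current string, the number of rounds is
quadratic in `L`, and the string length is `O(2^d L)`; constants are irrelevant for the
`2^{δ n} · poly(L)` bounds of the fine-grained statements, so no attempt at efficiency is made.

## References

* R. Impagliazzo, R. Paturi, *On the complexity of k-SAT*, JCSS 62 (2001) 367–375, §1
  (`s_k = inf {δ : k-SAT ∈ TIME(2^{δ n} poly)}`; exhaustive search gives `s_k ≤ 1`, implicit).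
  doi:10.1006/jcss.2000.1727 (not held; acq-00143).
* D. Lokshtanov, D. Marx, S. Saurabh, *Lower bounds based on the Exponential Time Hypothesis*,
  Bull. EATCS 105 (2011) 41–72, §2 p. 7 ("it is trivial to solve 3-CNF-Sat in time
  `2^n (n+m)^{O(1)}`").
* J. E. Hopcroft, J. D. Ullman, *Introduction to Automata Theory, Languages, and Computation*,
  Addison-Wesley 1979, §11.2 (generalised sequential machines; see `Transducers.lean`).
-/

namespace Literature.Computability.FineGrained.ExhSat

open Complexity

/-! ### Symbols, cells, bodies -/

/-- The four modes of a round: compare pivot bits (`cmp`), copy segments (`copy`), finish a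
pivot cycle (`fin`), search over (`done`). [folklore] -/
inductive Mode | cmp | copy | fin | done
  deriving DecidableEq, Fintype

/-- Status of a literal cell: unassigned, pivot, or assigned the value `v`. [folklore] -/
inductive St | u | p | a (v : Bool)
  deriving DecidableEq, Fintype

/-- The 24-letter alphabet of the loop string: the mode header, segment delimiters `seg`
(start), `cur` (copy cursor), `cpy1`/`cpy2` (the two copy regions), the terminator `stop`, the
clause separator `bar`, and the three kinds of cell symbols: `lit s pol` (status and polarity of
a literal), `bit b mk` (a bit of the variable code, possibly marked), `flg ne` (the trailing
"differs from the pivot" flag). [folklore] -/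
inductive Sym
  | hdr (m : Mode) | seg | cur | cpy1 | cpy2 | stop | bar
  | lit (s : St) (pol : Bool)
  | bit (b : Bool) (mk : Bool)
  | flg (ne : Bool)
  deriving DecidableEq, Fintype

/-- The default symbol (`stop`). [folklore] -/
instance : Inhabited Sym := ⟨Sym.stop⟩

/-- A literal cell: status, polarity, the (marked) bits of the variable code, and the flag
recording that the variable is known to differ from the pivot variable. [folklore] -/
structure Cell where
  /-- status: unassigned, pivot, or assigned a value -/
  st : St
  /-- polarity of the literal -/
  pol : Bool
  /-- the binary code of the variable, each bit with its comparison mark -/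
  bits : List (Bool × Bool)
  /-- `true` once the variable is known to differ from the pivot variable -/
  ne : Bool
  deriving DecidableEq

/-- A body: the clause list, each clause a list of cells. [folklore] -/
abbrev Body := List (List Cell)

/-- The string of a bit list: one `bit` symbol per (bit, mark) pair. [folklore] -/
def bitsStr (l : List (Bool × Bool)) : List Sym := l.map fun q => Sym.bit q.1 q.2

/-- The string of a cell: status/polarity symbol, bits, trailing flag. [folklore] -/
def cellStr (c : Cell) : List Sym := Sym.lit c.st c.pol :: (bitsStr c.bits ++ [Sym.flg c.ne])

/-- The string of a clause: a `bar` followed by its cells. [folklore] -/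
def clauseStr (cl : List Cell) : List Sym := Sym.bar :: cl.flatMap cellStr

/-- The string of a body: the concatenation of its clause strings. [folklore] -/
def bodyStr (B : Body) : List Sym := B.flatMap clauseStr

/-! ### The round transducer -/

/-- New status of a cell in the copy for value `v`. [folklore] -/
def newSt (v : Bool) : St → Bool → St
  | .p, _ => .a v
  | .u, true => .u
  | .u, false => .a v
  | .a w, _ => .a w

/-- Correction of a carried symbol written into the copy for value `v` (`ne` = the trailing flag
of its cell, for a `lit`). [folklore] -/
def corr (v : Bool) : Sym → Bool → Sym
  | .lit s pol, ne => .lit (newSt v s ne) pol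
  | .bit b _, _ => .bit b false
  | .flg _, _ => .flg false
  | x, _ => x

/-- States of the round transducer. [folklore] -/
inductive MS
  | start
  | cPre (sn ex : Bool)
  | cPiv (sn ex : Bool)
  | cCarry (ob : Option Bool) (sn ex : Bool)
  | cU (ob : Option Bool) (lk mis : Bool) (sn ex : Bool)
  | kPre (ex : Bool)
  | kCur (ex : Bool)
  | kSeek (x : Sym) (ex : Bool)
  | kCarry (x : Sym) (ne : Bool) (ex : Bool)
  | kC1 (x : Sym) (ne : Bool) (ex : Bool)
  | kC2 (x : Sym) (ne : Bool) (ex : Bool)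
  | kIdle (ex : Bool)
  | fDel (pk : Bool)
  | fC1 (pd pk : Bool)
  | fC2 (pd pk : Bool)
  | dn
  deriving DecidableEq, Fintype

/-- Transition table of the round transducer. [folklore] -/
def step : MS → Sym → MS × List Sym
  -- dispatch on the header
  | .start, .hdr .cmp => (.cPre false false, [])
  | .start, .hdr .copy => (.kPre false, [])
  | .start, .hdr .fin => (.fDel false, [])
  | .start, .hdr .done => (.dn, [])
  | .start, x => (.dn, [x])
  -- done: identity
  | .dn, x => (.dn, [x])
  -- cmp
  | .cPre _ ex, .lit .p pol => (.cPiv true ex, [.lit .p pol])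
  | .cPre sn ex, x => (.cPre sn ex, [x])
  | .cPiv sn ex, .bit b false => (.cCarry (some b) sn ex, [.bit b true])
  | .cPiv sn _, .flg ne => (.cCarry none sn true, [.flg ne])
  | .cPiv sn ex, x => (.cPiv sn ex, [x])
  | .cCarry ob sn ex, .lit .u pol => (.cU ob true false sn ex, [.lit .u pol])
  | .cCarry _ sn ex, .seg => (.cPre sn ex, [.seg])
  | .cCarry _ sn ex, .cpy1 => (.cPre sn ex, [.cpy1])
  | .cCarry ob sn ex, x => (.cCarry ob sn ex, [x])
  | .cU (some pb) true _ sn ex, .bit b false => (.cU (some pb) false (b != pb) sn ex, [.bit b true])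
  | .cU none true _ sn ex, .bit b false => (.cU none false true sn ex, [.bit b false])
  | .cU ob lk mis sn ex, .flg ne =>
      (.cCarry ob sn ex, [.flg (ne || (if lk then ob.isSome else mis))])
  | .cU ob lk mis sn ex, .bit b mk => (.cU ob lk mis sn ex, [.bit b mk])
  | .cU ob _ _ sn ex, x => (.cCarry ob sn ex, [x])
  -- copy
  | .kPre ex, .cur => (.kCur ex, [])
  | .kPre ex, x => (.kPre ex, [x])
  | .kCur _, .cpy1 => (.kIdle true, [.cur, .cpy1])
  | .kCur ex, .lit s pol => (.kSeek (.lit s pol) ex, [.lit s pol, .cur])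
  | .kCur ex, x => (.kCarry x false ex, [x, .cur])
  | .kSeek x ex, .flg ne => (.kCarry x ne ex, [.flg ne])
  | .kSeek x ex, .cpy1 => (.kC1 x false ex, [.cpy1])
  | .kSeek x ex, y => (.kSeek x ex, [y])
  | .kCarry x ne ex, .cpy1 => (.kC1 x ne ex, [.cpy1])
  | .kCarry x ne ex, y => (.kCarry x ne ex, [y])
  | .kC1 x ne ex, .cpy2 => (.kC2 x ne ex, [corr false x ne, .cpy2])
  | .kC1 x ne ex, y => (.kC1 x ne ex, [y])
  | .kC2 x ne ex, .seg => (.kPre ex, [corr true x ne, .seg])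
  | .kC2 x ne ex, .stop => (.kPre ex, [corr true x ne, .stop])
  | .kC2 x ne ex, y => (.kC2 x ne ex, [y])
  | .kIdle ex, .seg => (.kPre ex, [.seg])
  | .kIdle ex, y => (.kIdle ex, [y])
  -- fin
  | .fDel pk, .cpy1 => (.fC1 false pk, [.seg, .cur])
  | .fDel pk, .stop => (.fDel pk, [.stop])
  | .fDel pk, _ => (.fDel pk, [])
  | .fC1 false _, .lit .u pol => (.fC1 true true, [.lit .p pol])
  | .fC1 _ pk, .cpy2 => (.fC2 false pk, [.cpy1, .cpy2, .seg, .cur])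
  | .fC1 pd pk, y => (.fC1 pd pk, [y])
  | .fC2 false _, .lit .u pol => (.fC2 true true, [.lit .p pol])
  | .fC2 _ pk, .seg => (.fDel pk, [.cpy1, .cpy2])
  | .fC2 _ pk, .stop => (.fDel pk, [.cpy1, .cpy2, .stop])
  | .fC2 pd pk, y => (.fC2 pd pk, [y])

/-- The next mode after a `cmp` round. [folklore] -/
def cmpNext (sn ex : Bool) : Mode := if sn then (if ex then .copy else .cmp) else .done

/-- The header written in front of the output: the mode of the next round. [folklore] -/
def front : MS → List Sym
  | .cPre sn ex => [.hdr (cmpNext sn ex)]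
  | .cPiv sn ex => [.hdr (cmpNext sn ex)]
  | .cCarry _ sn ex => [.hdr (cmpNext sn ex)]
  | .cU _ _ _ sn ex => [.hdr (cmpNext sn ex)]
  | .kPre ex => [.hdr (if ex then .fin else .copy)]
  | .kCur ex => [.hdr (if ex then .fin else .copy)]
  | .kSeek _ ex => [.hdr (if ex then .fin else .copy)]
  | .kCarry _ _ ex => [.hdr (if ex then .fin else .copy)]
  | .kC1 _ _ ex => [.hdr (if ex then .fin else .copy)]
  | .kC2 _ _ ex => [.hdr (if ex then .fin else .copy)]
  | .kIdle ex => [.hdr (if ex then .fin else .copy)]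
  | .fDel pk => [.hdr (if pk then .cmp else .done)]
  | .fC1 _ pk => [.hdr (if pk then .cmp else .done)]
  | .fC2 _ pk => [.hdr (if pk then .cmp else .done)]
  | .dn => [.hdr .done]
  | .start => [.hdr .done]

/-- The round transducer. [folklore] -/
def roundFST : FST MS Sym Sym where
  init := .start
  step := step
  front := front
  keep := fun _ => true

/-- The step function of `roundFST` is `step`. [folklore] -/
@[simp] theorem roundFST_step (s : MS) (x : Sym) : roundFST.step s x = step s x := rfl

/-- One round. [folklore] -/
def F : List Sym → List Sym := roundFST.eval

/-- `F` in terms of the run from the initial state (the body is always kept). [folklore] -/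
theorem F_eq (l : List Sym) : F l = front (roundFST.run .start l).1 ++ (roundFST.run .start l).2 := by
  simp only [F, FST.eval]
  rfl

/-! ### Generic facts on runs -/

/-- Runs in the form "piece, then the rest". [folklore] -/
theorem run_cons_eq (s : MS) (x : Sym) (rest : List Sym) :
    roundFST.run s (x :: rest) =
      ((roundFST.run (step s x).1 rest).1, (step s x).2 ++ (roundFST.run (step s x).1 rest).2) := by
  simp [FST.run_cons]

/-! ### Semantics of a `cmp` round -/

/-- Mark the first unmarked bit and return it. [folklore] -/
def markFirst : List (Bool × Bool) → Option Bool × List (Bool × Bool)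
  | [] => (none, [])
  | (b, false) :: l => (some b, (b, true) :: l)
  | (b, true) :: l => ((markFirst l).1, (b, true) :: (markFirst l).2)

/-- Whether some bit is unmarked. [folklore] -/
def hasUnmarked (l : List (Bool × Bool)) : Bool := l.any fun q => !q.2

/-- Mismatch of the found bit with the pivot bit `pb` (no bit found = mismatch). [folklore] -/
def mis (pb : Bool) : Option Bool → Bool
  | some b => b != pb
  | none => true

/-- Phase of a `cmp` round inside a segment: before the pivot, or after it carrying the pivot
bit (`none` = pivot exhausted). [folklore] -/
inductive Ph | pre | carry (ob : Option Bool)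
  deriving DecidableEq

/-- Phase with the two sticky flags (pivot seen, pivot exhausted). [folklore] -/
structure CSt where
  /-- phase: before the pivot, or carrying the pivot's comparison bit (`none` = exhausted) -/
  ph : Ph
  /-- some cell is still unassigned -/
  sn : Bool
  /-- the pivot code is exhausted -/
  ex : Bool

/-- The transducer state between two cells. [folklore] -/
def CSt.ms : CSt → MS
  | ⟨.pre, sn, ex⟩ => .cPre sn ex
  | ⟨.carry ob, sn, ex⟩ => .cCarry ob sn ex

/-- Effect of a `cmp` round on one cell. [folklore] -/
def cmpCell : CSt → Cell → CSt × Cell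
  | ⟨.pre, sn, ex⟩, c =>
      if c.st = .p then
        (⟨.carry (markFirst c.bits).1, true, ex || (markFirst c.bits).1.isNone⟩,
          {c with bits := (markFirst c.bits).2})
      else (⟨.pre, sn, ex⟩, c)
  | ⟨.carry (some pb), sn, ex⟩, c =>
      if c.st = .u then
        (⟨.carry (some pb), sn, ex⟩,
          {c with bits := (markFirst c.bits).2, ne := c.ne || mis pb (markFirst c.bits).1})
      else (⟨.carry (some pb), sn, ex⟩, c)
  | ⟨.carry none, sn, ex⟩, c =>
      if c.st = .u then (⟨.carry none, sn, ex⟩, {c with ne := c.ne || hasUnmarked c.bits})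
      else (⟨.carry none, sn, ex⟩, c)

/-- Effect of a `cmp` round on a list of cells. [folklore] -/
def cmpCells : CSt → List Cell → CSt × List Cell
  | S, [] => (S, [])
  | S, c :: cs => ((cmpCells (cmpCell S c).1 cs).1, (cmpCell S c).2 :: (cmpCells (cmpCell S c).1 cs).2)

/-- Effect of a `cmp` round on a body. [folklore] -/
def cmpBody : CSt → Body → CSt × Body
  | S, [] => (S, [])
  | S, cl :: B => ((cmpBody (cmpCells S cl).1 B).1, (cmpCells S cl).2 :: (cmpBody (cmpCells S cl).1 B).2)

/-- In state `cCarry`, bits pass. [folklore] -/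
theorem run_cCarry_bits (ob : Option Bool) (sn ex : Bool) (bits : List (Bool × Bool)) (rest : List Sym) :
    roundFST.run (.cCarry ob sn ex) (bitsStr bits ++ rest) =
      ((roundFST.run (.cCarry ob sn ex) rest).1, bitsStr bits ++ (roundFST.run (.cCarry ob sn ex) rest).2) := by
  induction bits with
  | nil => simp [bitsStr]
  | cons q bits ih =>
    obtain ⟨b, m⟩ := q
    simp [bitsStr] at ih ⊢
    simp [step, ih]

/-- The pivot cell: mark the first unmarked bit and carry it, or become exhausted. [folklore] -/
theorem run_cPiv (sn ex : Bool) (bits : List (Bool × Bool)) (ne : Bool) (rest : List Sym) :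
    roundFST.run (.cPiv sn ex) (bitsStr bits ++ Sym.flg ne :: rest) =
      ((roundFST.run (.cCarry (markFirst bits).1 sn (ex || (markFirst bits).1.isNone)) rest).1,
        bitsStr (markFirst bits).2 ++ Sym.flg ne ::
          (roundFST.run (.cCarry (markFirst bits).1 sn (ex || (markFirst bits).1.isNone)) rest).2) := by
  induction bits with
  | nil => simp [bitsStr, markFirst, step]
  | cons q bits ih =>
    obtain ⟨b, m⟩ := q
    cases m
    · have := run_cCarry_bits (some b) sn ex bits (Sym.flg ne :: rest)
      simp [bitsStr] at this ⊢
      simp [step, markFirst, this]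
    · simp [bitsStr] at ih ⊢
      simp [step, markFirst, ih]

/-- A `u`-cell after the first unmarked bit was handled: the rest passes, the flag absorbs `m`. [folklore] -/
theorem run_cU_found (ob : Option Bool) (m sn ex : Bool) (bits : List (Bool × Bool)) (ne : Bool)
    (rest : List Sym) :
    roundFST.run (.cU ob false m sn ex) (bitsStr bits ++ Sym.flg ne :: rest) =
      ((roundFST.run (.cCarry ob sn ex) rest).1,
        bitsStr bits ++ Sym.flg (ne || m) :: (roundFST.run (.cCarry ob sn ex) rest).2) := by
  induction bits with
  | nil => cases ob <;> simp [bitsStr, step]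
  | cons q bits ih =>
    obtain ⟨b, mk⟩ := q
    simp [bitsStr] at ih ⊢
    cases ob <;> cases mk <;> simp [step, ih]

/-- A `u`-cell compared with the pivot bit `pb`. [folklore] -/
theorem run_cU_some (pb sn ex : Bool) (bits : List (Bool × Bool)) (ne : Bool) (rest : List Sym) :
    roundFST.run (.cU (some pb) true false sn ex) (bitsStr bits ++ Sym.flg ne :: rest) =
      ((roundFST.run (.cCarry (some pb) sn ex) rest).1,
        bitsStr (markFirst bits).2 ++ Sym.flg (ne || mis pb (markFirst bits).1) ::
          (roundFST.run (.cCarry (some pb) sn ex) rest).2) := by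
  induction bits with
  | nil => simp [bitsStr, markFirst, mis, step]
  | cons q bits ih =>
    obtain ⟨b, mk⟩ := q
    cases mk
    · have := run_cU_found (some pb) (b != pb) sn ex bits ne rest
      simp [bitsStr] at this ⊢
      simp [step, markFirst, mis, this]
    · simp [bitsStr] at ih ⊢
      simp [step, markFirst, ih]

/-- A `u`-cell in the exhaustion round: any unmarked bit is a mismatch. [folklore] -/
theorem run_cU_none (sn ex : Bool) (bits : List (Bool × Bool)) (ne : Bool) (rest : List Sym) :
    roundFST.run (.cU none true false sn ex) (bitsStr bits ++ Sym.flg ne :: rest) =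
      ((roundFST.run (.cCarry none sn ex) rest).1,
        bitsStr bits ++ Sym.flg (ne || hasUnmarked bits) ::
          (roundFST.run (.cCarry none sn ex) rest).2) := by
  induction bits with
  | nil => simp [bitsStr, hasUnmarked, step]
  | cons q bits ih =>
    obtain ⟨b, mk⟩ := q
    cases mk
    · have := run_cU_found none true sn ex bits ne rest
      simp [bitsStr] at this ⊢
      simp [step, hasUnmarked, this]
    · simp [bitsStr] at ih ⊢
      simp [step, hasUnmarked, ih]

/-- In state `cPre`, bits pass. [folklore] -/
theorem run_cPre_bits (sn ex : Bool) (bits : List (Bool × Bool)) (rest : List Sym) :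
    roundFST.run (.cPre sn ex) (bitsStr bits ++ rest) =
      ((roundFST.run (.cPre sn ex) rest).1, bitsStr bits ++ (roundFST.run (.cPre sn ex) rest).2) := by
  induction bits with
  | nil => simp [bitsStr]
  | cons q bits ih =>
    obtain ⟨b, m⟩ := q
    simp [bitsStr] at ih ⊢
    simp [step, ih]

/-- **A `cmp` round on one cell.** [folklore] -/
theorem run_cmpCell (S : CSt) (c : Cell) (rest : List Sym) :
    roundFST.run S.ms (cellStr c ++ rest) =
      ((roundFST.run (cmpCell S c).1.ms rest).1,
        cellStr (cmpCell S c).2 ++ (roundFST.run (cmpCell S c).1.ms rest).2) := by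
  obtain ⟨ph, sn, ex⟩ := S
  obtain ⟨st, pol, bits, ne⟩ := c
  cases ph with
  | pre =>
    cases st with
    | p =>
      have := run_cPiv true ex bits ne rest
      simp [CSt.ms, cellStr, cmpCell, step, this]
    | u =>
      have := run_cPre_bits sn ex bits (Sym.flg ne :: rest)
      simp [CSt.ms, cellStr, cmpCell, step, this]
    | a v =>
      have := run_cPre_bits sn ex bits (Sym.flg ne :: rest)
      simp [CSt.ms, cellStr, cmpCell, step, this]
  | carry ob =>
    cases ob with
    | none =>
      cases st with
      | u =>
        have := run_cU_none sn ex bits ne rest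
        simp [CSt.ms, cellStr, cmpCell, step, this]
      | p =>
        have := run_cCarry_bits none sn ex bits (Sym.flg ne :: rest)
        simp [CSt.ms, cellStr, cmpCell, step, this]
      | a v =>
        have := run_cCarry_bits none sn ex bits (Sym.flg ne :: rest)
        simp [CSt.ms, cellStr, cmpCell, step, this]
    | some pb =>
      cases st with
      | u =>
        have := run_cU_some pb sn ex bits ne rest
        simp [CSt.ms, cellStr, cmpCell, step, this]
      | p =>
        have := run_cCarry_bits (some pb) sn ex bits (Sym.flg ne :: rest)
        simp [CSt.ms, cellStr, cmpCell, step, this]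
      | a v =>
        have := run_cCarry_bits (some pb) sn ex bits (Sym.flg ne :: rest)
        simp [CSt.ms, cellStr, cmpCell, step, this]

/-- `bar` passes between cells. [folklore] -/
theorem run_ms_bar (S : CSt) (rest : List Sym) :
    roundFST.run S.ms (Sym.bar :: rest) = ((roundFST.run S.ms rest).1, Sym.bar :: (roundFST.run S.ms rest).2) := by
  obtain ⟨ph, sn, ex⟩ := S
  cases ph <;> simp [CSt.ms, step]

/-- **A `cmp` round on a list of cells.** [folklore] -/
theorem run_cmpCells (S : CSt) (cs : List Cell) (rest : List Sym) :
    roundFST.run S.ms (cs.flatMap cellStr ++ rest) =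
      ((roundFST.run (cmpCells S cs).1.ms rest).1,
        (cmpCells S cs).2.flatMap cellStr ++ (roundFST.run (cmpCells S cs).1.ms rest).2) := by
  induction cs generalizing S with
  | nil => simp [cmpCells]
  | cons c cs ih =>
    simp only [List.flatMap_cons, List.append_assoc, cmpCells]
    rw [run_cmpCell, ih]

/-- **A `cmp` round on a body.** [folklore] -/
theorem run_cmpBody (S : CSt) (B : Body) (rest : List Sym) :
    roundFST.run S.ms (bodyStr B ++ rest) =
      ((roundFST.run (cmpBody S B).1.ms rest).1,
        bodyStr (cmpBody S B).2 ++ (roundFST.run (cmpBody S B).1.ms rest).2) := by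
  induction B generalizing S with
  | nil => simp [bodyStr, cmpBody]
  | cons cl B ih =>
    simp only [bodyStr, List.flatMap_cons, clauseStr, List.cons_append, List.append_assoc,
      cmpBody] at ih ⊢
    rw [run_ms_bar, run_cmpCells, ih]

/-! ### String layouts -/

/-- A segment with (flat) body `s` in the plain layout: `seg cur s cpy1 cpy2`. [folklore] -/
def segStrF (s : List Sym) : List Sym := Sym.seg :: Sym.cur :: (s ++ [Sym.cpy1, Sym.cpy2])

/-- The plain layout: header, segments, `stop`. [folklore] -/
def plainStrF (m : Mode) (ss : List (List Sym)) : List Sym :=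
  Sym.hdr m :: (ss.flatMap segStrF ++ [Sym.stop])

/-- **A `cmp` round on a segment** (entered and left in state `cPre`). [folklore] -/
theorem run_cmpSeg (sn ex : Bool) (B : Body) (rest : List Sym) :
    roundFST.run (.cPre sn ex) (segStrF (bodyStr B) ++ rest) =
      ((roundFST.run (.cPre (cmpBody ⟨.pre, sn, ex⟩ B).1.sn (cmpBody ⟨.pre, sn, ex⟩ B).1.ex) rest).1,
        segStrF (bodyStr (cmpBody ⟨.pre, sn, ex⟩ B).2) ++
          (roundFST.run (.cPre (cmpBody ⟨.pre, sn, ex⟩ B).1.sn (cmpBody ⟨.pre, sn, ex⟩ B).1.ex) rest).2) := by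
  have h := run_cmpBody ⟨.pre, sn, ex⟩ B (Sym.cpy1 :: Sym.cpy2 :: rest)
  simp only [CSt.ms] at h
  simp only [segStrF, List.cons_append, List.append_assoc, FST.run_cons, roundFST_step, step,
    List.nil_append, h]
  obtain ⟨ph, sn', ex'⟩ := (cmpBody ⟨.pre, sn, ex⟩ B).1
  cases ph <;> simp

/-- Effect of a `cmp` round on the list of segments, threading the flags. [folklore] -/
def cmpSegs : Bool → Bool → List Body → (Bool × Bool) × List Body
  | sn, ex, [] => ((sn, ex), [])
  | sn, ex, B :: segs =>
      ((cmpSegs (cmpBody ⟨.pre, sn, ex⟩ B).1.sn (cmpBody ⟨.pre, sn, ex⟩ B).1.ex segs).1,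
        (cmpBody ⟨.pre, sn, ex⟩ B).2 ::
          (cmpSegs (cmpBody ⟨.pre, sn, ex⟩ B).1.sn (cmpBody ⟨.pre, sn, ex⟩ B).1.ex segs).2)

/-- A `cmp` round on all segments. [folklore] -/
theorem run_cmpSegs (sn ex : Bool) (segs : List Body) (rest : List Sym) :
    roundFST.run (.cPre sn ex) ((segs.map bodyStr).flatMap segStrF ++ rest) =
      ((roundFST.run (.cPre (cmpSegs sn ex segs).1.1 (cmpSegs sn ex segs).1.2) rest).1,
        ((cmpSegs sn ex segs).2.map bodyStr).flatMap segStrF ++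
          (roundFST.run (.cPre (cmpSegs sn ex segs).1.1 (cmpSegs sn ex segs).1.2) rest).2) := by
  induction segs generalizing sn ex with
  | nil => simp [cmpSegs]
  | cons B segs ih =>
    simp only [List.map_cons, List.flatMap_cons, List.append_assoc, cmpSegs]
    rw [run_cmpSeg, ih]

/-- **The `cmp` round.** [folklore] -/
theorem F_cmp (segs : List Body) :
    F (plainStrF .cmp (segs.map bodyStr)) =
      plainStrF (cmpNext (cmpSegs false false segs).1.1 (cmpSegs false false segs).1.2)
        ((cmpSegs false false segs).2.map bodyStr) := by
  have h := run_cmpSegs false false segs [Sym.stop]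
  simp only [F, FST.eval, roundFST, plainStrF, FST.run_cons, step] at h ⊢
  simp [h, front]

/-! ### Semantics of a `copy` round -/

/-- The trailing flag of the cell a symbol belongs to: the flag of the next `flg` symbol. [folklore] -/
def neAhead : List Sym → Bool
  | [] => false
  | Sym.flg ne :: _ => ne
  | _ :: l => neAhead l

/-- The corrected copy of a flat body for the value `v`. [folklore] -/
def corrStr (v : Bool) : List Sym → List Sym
  | [] => []
  | x :: l => corr v x (neAhead l) :: corrStr v l

/-- `corrStr` preserves the length. [folklore] -/
@[simp] theorem length_corrStr (v : Bool) (s : List Sym) : (corrStr v s).length = s.length := by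
  induction s with
  | nil => rfl
  | cons x l ih => simp [corrStr, ih]

/-- Symbols that may occur in a flat body. [folklore] -/
def IsBodySym : Sym → Prop
  | .bar | .lit _ _ | .bit _ _ | .flg _ => True
  | _ => False

/-- `IsBodySym` is decidable. [folklore] -/
instance : DecidablePred IsBodySym := fun x => by cases x <;> simp [IsBodySym] <;> infer_instance

/-- A segment in the copy layout with cursor `k`: `seg (take k s) cur (drop k s) cpy1 C₁ cpy2 C₂`
with `C_v = take k (corrStr v s)`. The leading `seg` is not included. [folklore] -/
def segTailK (k : ℕ) (s : List Sym) : List Sym :=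
  s.take k ++ Sym.cur :: (s.drop k ++ Sym.cpy1 :: ((corrStr false s).take k ++
    Sym.cpy2 :: (corrStr true s).take k))

/-- The copy layout. [folklore] -/
def copyStrF (m : Mode) (k : ℕ) (ss : List (List Sym)) : List Sym :=
  Sym.hdr m :: (ss.flatMap (fun s => Sym.seg :: segTailK k s) ++ [Sym.stop])

/-- With cursor `0` the copy layout is the plain layout. [folklore] -/
theorem copyStrF_zero (m : Mode) (ss : List (List Sym)) : copyStrF m 0 ss = plainStrF m ss := by
  simp only [copyStrF, plainStrF, segTailK, List.take_zero, List.drop_zero, List.nil_append]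
  rfl

/-- `corr` only reads the flag for a `lit`. [folklore] -/
theorem corr_of_not_lit (v : Bool) (x : Sym) (ne : Bool) (hx : ∀ s pol, x ≠ .lit s pol) :
    corr v x ne = corr v x false := by
  cases x <;> simp_all [corr]

/-- The `k`-th symbol of the corrected copy. [folklore] -/
theorem getElem?_corrStr (v : Bool) (s : List Sym) (k : ℕ) :
    (corrStr v s)[k]? = (s[k]?).map fun x => corr v x (neAhead (s.drop (k + 1))) := by
  induction s generalizing k with
  | nil => simp [corrStr]
  | cons x l ih =>
    cases k with
    | zero => simp [corrStr]
    | succ k => simp [corrStr, ih]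

/-- `take (k+1)` of the corrected copy, when `s[k] = x`. [folklore] -/
theorem take_succ_corrStr (v : Bool) {s : List Sym} {k : ℕ} {x : Sym} {t : List Sym}
    (h : s.drop k = x :: t) :
    (corrStr v s).take (k + 1) = (corrStr v s).take k ++ [corr v x (neAhead t)] := by
  rw [List.take_add_one, getElem?_corrStr]
  have hk : s[k]? = some x := by
    rw [← List.head?_drop, h]; rfl
  have ht : s.drop (k + 1) = t := by
    rw [← List.drop_drop, h]; rfl
  simp [hk, ht]

/-- Body symbols pass in state `kPre`. [folklore] -/
theorem run_kPre_body (ex : Bool) (w : List Sym) (hw : ∀ x ∈ w, IsBodySym x) (rest : List Sym) :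
    roundFST.run (.kPre ex) (w ++ rest) =
      ((roundFST.run (.kPre ex) rest).1, w ++ (roundFST.run (.kPre ex) rest).2) := by
  induction w with
  | nil => simp
  | cons y w ih =>
    have hy := hw y (by simp)
    have ih' := ih (fun x hx => hw x (by simp [hx]))
    cases y <;> simp_all [IsBodySym, step]

/-- Body symbols pass in state `kCarry`. [folklore] -/
theorem run_kCarry_body (x : Sym) (ne ex : Bool) (w : List Sym) (hw : ∀ y ∈ w, IsBodySym y)
    (rest : List Sym) :
    roundFST.run (.kCarry x ne ex) (w ++ rest) =
      ((roundFST.run (.kCarry x ne ex) rest).1, w ++ (roundFST.run (.kCarry x ne ex) rest).2) := by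
  induction w with
  | nil => simp
  | cons y w ih =>
    have hy := hw y (by simp)
    have ih' := ih (fun x hx => hw x (by simp [hx]))
    cases y <;> simp_all [IsBodySym, step]

/-- Body symbols pass in state `kC1`. [folklore] -/
theorem run_kC1_body (x : Sym) (ne ex : Bool) (w : List Sym) (hw : ∀ y ∈ w, IsBodySym y)
    (rest : List Sym) :
    roundFST.run (.kC1 x ne ex) (w ++ rest) =
      ((roundFST.run (.kC1 x ne ex) rest).1, w ++ (roundFST.run (.kC1 x ne ex) rest).2) := by
  induction w with
  | nil => simp
  | cons y w ih =>
    have hy := hw y (by simp)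
    have ih' := ih (fun x hx => hw x (by simp [hx]))
    cases y <;> simp_all [IsBodySym, step]

/-- Body symbols pass in state `kC2`. [folklore] -/
theorem run_kC2_body (x : Sym) (ne ex : Bool) (w : List Sym) (hw : ∀ y ∈ w, IsBodySym y)
    (rest : List Sym) :
    roundFST.run (.kC2 x ne ex) (w ++ rest) =
      ((roundFST.run (.kC2 x ne ex) rest).1, w ++ (roundFST.run (.kC2 x ne ex) rest).2) := by
  induction w with
  | nil => simp
  | cons y w ih =>
    have hy := hw y (by simp)
    have ih' := ih (fun x hx => hw x (by simp [hx]))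
    cases y <;> simp_all [IsBodySym, step]

/-- Body symbols pass in state `kIdle`. [folklore] -/
theorem run_kIdle_body (ex : Bool) (w : List Sym) (hw : ∀ y ∈ w, IsBodySym y) (rest : List Sym) :
    roundFST.run (.kIdle ex) (w ++ rest) =
      ((roundFST.run (.kIdle ex) rest).1, w ++ (roundFST.run (.kIdle ex) rest).2) := by
  induction w with
  | nil => simp
  | cons y w ih =>
    have hy := hw y (by simp)
    have ih' := ih (fun x hx => hw x (by simp [hx]))
    cases y <;> simp_all [IsBodySym, step]

/-- The context flag picked up while scanning the rest `t` of the original after the carried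
symbol `x`: the trailing flag of its cell for a `lit`, irrelevant (`false`) otherwise. [folklore] -/
def ctx (x : Sym) (t : List Sym) : Bool :=
  match x with
  | .lit _ _ => neAhead t
  | _ => false

/-- `corr` with the context flag is `corr` with `neAhead`. [folklore] -/
theorem corr_ctx (v : Bool) (x : Sym) (t : List Sym) : corr v x (ctx x t) = corr v x (neAhead t) := by
  cases x <;> simp [ctx, corr]

/-- Scanning for the trailing flag: in state `kSeek`, body symbols up to `cpy1` pass and the
state ends in `kC1` with the flag `neAhead`. [folklore] -/
theorem run_kSeek_body (x : Sym) (ex : Bool) (t : List Sym) (ht : ∀ y ∈ t, IsBodySym y)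
    (rest : List Sym) :
    roundFST.run (.kSeek x ex) (t ++ Sym.cpy1 :: rest) =
      ((roundFST.run (.kC1 x (neAhead t) ex) rest).1,
        t ++ Sym.cpy1 :: (roundFST.run (.kC1 x (neAhead t) ex) rest).2) := by
  induction t with
  | nil => simp [neAhead, step]
  | cons y t ih =>
    have hy := ht y (by simp)
    have ih' := ih (fun z hz => ht z (by simp [hz]))
    cases y with
    | flg ne =>
      have := run_kCarry_body x ne ex t (fun z hz => ht z (by simp [hz])) (Sym.cpy1 :: rest)
      simp [neAhead, step, this]
    | _ => simp_all [IsBodySym, neAhead, step]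

/-- After the cursor: the carried symbol `x` and the rest `t` of the original, up to `cpy1`. [folklore] -/
theorem run_kCur_cons (ex : Bool) (x : Sym) (hx : IsBodySym x) (t : List Sym)
    (ht : ∀ y ∈ t, IsBodySym y) (rest : List Sym) :
    roundFST.run (.kCur ex) (x :: (t ++ Sym.cpy1 :: rest)) =
      ((roundFST.run (.kC1 x (ctx x t) ex) rest).1,
        x :: Sym.cur :: (t ++ Sym.cpy1 :: (roundFST.run (.kC1 x (ctx x t) ex) rest).2)) := by
  cases x with
  | lit s pol =>
    have := run_kSeek_body (.lit s pol) ex t ht rest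
    simp [step, ctx, this]
  | bar =>
    have := run_kCarry_body .bar false ex t ht (Sym.cpy1 :: rest)
    simp [step, ctx, this]
  | bit b mk =>
    have := run_kCarry_body (.bit b mk) false ex t ht (Sym.cpy1 :: rest)
    simp [step, ctx, this]
  | flg ne =>
    have := run_kCarry_body (.flg ne) false ex t ht (Sym.cpy1 :: rest)
    simp [step, ctx, this]
  | _ => simp [IsBodySym] at hx

/-- Corrections of body symbols are body symbols. [folklore] -/
theorem isBodySym_corr (v : Bool) (x : Sym) (ne : Bool) (hx : IsBodySym x) : IsBodySym (corr v x ne) := by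
  cases x <;> simp_all [IsBodySym, corr]

/-- `corrStr` maps body strings to body strings. [folklore] -/
theorem isBodySym_corrStr (v : Bool) (s : List Sym) (hs : ∀ x ∈ s, IsBodySym x) :
    ∀ x ∈ corrStr v s, IsBodySym x := by
  induction s with
  | nil => simp [corrStr]
  | cons y l ih =>
    intro x hx
    simp only [corrStr, List.mem_cons] at hx
    rcases hx with rfl | hx
    · exact isBodySym_corr v y _ (hs y (by simp))
    · exact ih (fun z hz => hs z (by simp [hz])) x hx

/-- **A `copy` round on a segment whose cursor is not at the end** (`drop k s = x :: t`): the
cursor advances and the corrected symbol is appended to the first copy; the one for the second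
copy is pending in the final state `kC2` (it is written in front of the next `seg`/`stop`). [folklore] -/
theorem run_copySeg_lt (ex : Bool) (s : List Sym) (hs : ∀ y ∈ s, IsBodySym y) (k : ℕ) (x : Sym)
    (t : List Sym) (hk : s.drop k = x :: t) (rest : List Sym) :
    roundFST.run (.kPre ex) (segTailK k s ++ rest) =
      ((roundFST.run (.kC2 x (ctx x t) ex) rest).1,
        s.take (k + 1) ++ Sym.cur :: (s.drop (k + 1) ++ Sym.cpy1 :: ((corrStr false s).take (k + 1) ++
          Sym.cpy2 :: ((corrStr true s).take k ++ (roundFST.run (.kC2 x (ctx x t) ex) rest).2)))) := by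
  have hx : IsBodySym x := hs x (List.mem_of_mem_drop (by rw [hk]; simp))
  have ht : ∀ y ∈ t, IsBodySym y := fun y hy =>
    hs y (List.mem_of_mem_drop (i := k) (by rw [hk]; exact List.mem_cons_of_mem x hy))
  have htk : s.take (k + 1) = s.take k ++ [x] := by
    rw [List.take_add_one]
    have : s[k]? = some x := by rw [← List.head?_drop, hk]; rfl
    simp [this]
  have hdk : s.drop (k + 1) = t := by rw [← List.drop_drop, hk]; rfl
  rw [take_succ_corrStr false hk, htk, hdk]
  simp only [segTailK, List.append_assoc, List.cons_append]
  rw [run_kPre_body ex _ (fun y hy => hs y (List.mem_of_mem_take hy)), run_cons_eq]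
  simp only [step, List.nil_append, hk, List.cons_append]
  rw [run_kCur_cons ex x hx t ht]
  rw [run_kC1_body _ _ _ _ (fun y hy => isBodySym_corrStr false s hs y (List.mem_of_mem_take hy))]
  simp only [FST.run_cons, roundFST_step, step]
  rw [run_kC2_body _ _ _ _ (fun y hy => isBodySym_corrStr true s hs y (List.mem_of_mem_take hy))]
  simp [corr_ctx]

/-- All segments of a `copy` round with the cursor not at the end, entered with a pending
symbol. [folklore] -/
theorem run_copySegs_lt (ex : Bool) (k : ℕ) (ss : List (List Sym))
    (h : ∀ s ∈ ss, (∀ y ∈ s, IsBodySym y) ∧ k < s.length) (x : Sym) (c : Bool) :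
    roundFST.run (.kC2 x c ex) (ss.flatMap (fun s => Sym.seg :: segTailK k s) ++ [Sym.stop]) =
      (.kPre ex, corr true x c :: (ss.flatMap (fun s => Sym.seg :: segTailK (k + 1) s) ++ [Sym.stop])) := by
  induction ss generalizing x c with
  | nil => simp [step]
  | cons s ss ih =>
    obtain ⟨hs, hk⟩ := h s (by simp)
    have ih' := ih (fun s' hs' => h s' (by simp [hs']))
    obtain ⟨x', t, hxt⟩ : ∃ x' t, s.drop k = x' :: t := by
      cases hd : s.drop k with
      | nil => exact absurd (List.drop_eq_nil_iff.1 hd) (by omega)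
      | cons x' t => exact ⟨x', t, rfl⟩
    simp only [List.flatMap_cons, List.cons_append, List.append_assoc, FST.run_cons, roundFST_step,
      step]
    rw [run_copySeg_lt ex s hs k x' t hxt, ih']
    simp only [segTailK]
    rw [take_succ_corrStr true hxt, corr_ctx]
    simp

/-- **The `copy` round, cursor not at the end**: the cursor advances in every segment. [folklore] -/
theorem F_copy_lt (k : ℕ) (ss : List (List Sym))
    (h : ∀ s ∈ ss, (∀ y ∈ s, IsBodySym y) ∧ k < s.length) :
    F (copyStrF .copy k ss) = copyStrF .copy (k + 1) ss := by
  cases ss with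
  | nil => simp only [copyStrF, List.flatMap_nil, List.nil_append]; decide
  | cons s ss =>
    obtain ⟨hs, hk⟩ := h s (by simp)
    obtain ⟨x', t, hxt⟩ : ∃ x' t, s.drop k = x' :: t := by
      cases hd : s.drop k with
      | nil => exact absurd (List.drop_eq_nil_iff.1 hd) (by omega)
      | cons x' t => exact ⟨x', t, rfl⟩
    have h2 := run_copySegs_lt false k ss (fun s' hs' => h s' (by simp [hs'])) x' (ctx x' t)
    simp only [F_eq, copyStrF, List.flatMap_cons, List.cons_append, List.append_assoc, FST.run_cons,
      roundFST_step, step, List.nil_append]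
    rw [run_copySeg_lt false s hs k x' t hxt, h2]
    simp only [segTailK, front]
    rw [take_succ_corrStr true hxt, corr_ctx]
    simp

/-- A `copy` round on a segment whose cursor is at the end: nothing changes, the state becomes
`kIdle true`. [folklore] -/
theorem run_copySeg_ge (ex : Bool) (s : List Sym) (hs : ∀ y ∈ s, IsBodySym y) (k : ℕ)
    (hk : s.length ≤ k) (rest : List Sym) :
    roundFST.run (.kPre ex) (segTailK k s ++ rest) =
      ((roundFST.run (.kIdle true) rest).1, segTailK k s ++ (roundFST.run (.kIdle true) rest).2) := by
  have h1 : s.take k = s := List.take_of_length_le hk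
  have h2 : s.drop k = [] := List.drop_eq_nil_iff.2 hk
  simp only [segTailK, h1, h2, List.nil_append, List.append_assoc, List.cons_append]
  rw [run_kPre_body ex s hs]
  simp only [FST.run_cons, roundFST_step, step, List.nil_append, List.cons_append]
  rw [run_kIdle_body _ _ (fun y hy => isBodySym_corrStr false s hs y (List.mem_of_mem_take hy))]
  simp only [FST.run_cons, roundFST_step, step, List.cons_append]
  rw [run_kIdle_body _ _ (fun y hy => isBodySym_corrStr true s hs y (List.mem_of_mem_take hy))]
  simp

/-- All segments of a `copy` round with the cursor at the end. [folklore] -/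
theorem run_copySegs_ge (k : ℕ) (ss : List (List Sym))
    (h : ∀ s ∈ ss, (∀ y ∈ s, IsBodySym y) ∧ s.length ≤ k) :
    roundFST.run (.kIdle true) (ss.flatMap (fun s => Sym.seg :: segTailK k s) ++ [Sym.stop]) =
      (.kIdle true, ss.flatMap (fun s => Sym.seg :: segTailK k s) ++ [Sym.stop]) := by
  induction ss with
  | nil => simp [step]
  | cons s ss ih =>
    obtain ⟨hs, hk⟩ := h s (by simp)
    have ih' := ih (fun s' hs' => h s' (by simp [hs']))
    simp only [List.flatMap_cons, List.cons_append, List.append_assoc, FST.run_cons, roundFST_step,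
      step]
    rw [run_copySeg_ge true s hs k hk, ih']
    simp

/-- **The `copy` round, cursor at the end**: nothing changes but the mode, which becomes `fin`. [folklore] -/
theorem F_copy_ge (k : ℕ) (ss : List (List Sym)) (hne : ss ≠ [])
    (h : ∀ s ∈ ss, (∀ y ∈ s, IsBodySym y) ∧ s.length ≤ k) :
    F (copyStrF .copy k ss) = copyStrF .fin k ss := by
  cases ss with
  | nil => exact absurd rfl hne
  | cons s ss =>
    obtain ⟨hs, hk⟩ := h s (by simp)
    have h2 := run_copySegs_ge k ss (fun s' hs' => h s' (by simp [hs']))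
    simp only [F_eq, copyStrF, List.flatMap_cons, List.cons_append, List.append_assoc, FST.run_cons,
      roundFST_step, step, List.nil_append]
    rw [run_copySeg_ge false s hs k hk, h2]
    simp [front]

/-! ### Semantics of a `fin` round -/

/-- Picking the first unassigned cell as the new pivot, threading the flags
(`pd` = already picked in this copy, `pk` = picked in some copy). [folklore] -/
def pickRun : Bool → Bool → List Sym → (Bool × Bool) × List Sym
  | pd, pk, [] => ((pd, pk), [])
  | false, _, Sym.lit .u pol :: l => ((pickRun true true l).1, Sym.lit .p pol :: (pickRun true true l).2)
  | pd, pk, y :: l => ((pickRun pd pk l).1, y :: (pickRun pd pk l).2)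

/-- Body symbols are deleted in state `fDel`. [folklore] -/
theorem run_fDel_body (pk : Bool) (w : List Sym) (hw : ∀ y ∈ w, IsBodySym y) (rest : List Sym) :
    roundFST.run (.fDel pk) (w ++ rest) = roundFST.run (.fDel pk) rest := by
  induction w with
  | nil => simp
  | cons y w ih =>
    have hy := hw y (by simp)
    have ih' := ih (fun x hx => hw x (by simp [hx]))
    cases y <;> simp_all [IsBodySym, step]

/-- The first copy: pick, up to `cpy2`. [folklore] -/
theorem run_fC1 (pd pk : Bool) (C : List Sym) (hC : ∀ y ∈ C, IsBodySym y) (rest : List Sym) :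
    roundFST.run (.fC1 pd pk) (C ++ Sym.cpy2 :: rest) =
      ((roundFST.run (.fC2 false (pickRun pd pk C).1.2) rest).1,
        (pickRun pd pk C).2 ++ Sym.cpy1 :: Sym.cpy2 :: Sym.seg :: Sym.cur ::
          (roundFST.run (.fC2 false (pickRun pd pk C).1.2) rest).2) := by
  induction C generalizing pd pk with
  | nil => simp [pickRun, step]
  | cons y C ih =>
    have hy := hC y (by simp)
    have ih' := fun pd pk => ih pd pk (fun x hx => hC x (by simp [hx]))
    cases y with
    | lit s pol => cases s <;> cases pd <;> simp [pickRun, step, ih']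
    | bar => cases pd <;> simp [pickRun, step, ih']
    | bit b mk => cases pd <;> simp [pickRun, step, ih']
    | flg ne => cases pd <;> simp [pickRun, step, ih']
    | _ => simp [IsBodySym] at hy

/-- The second copy: pick, up to the end of the segment (the state then meets `seg` or `stop`). [folklore] -/
theorem run_fC2 (pd pk : Bool) (C : List Sym) (hC : ∀ y ∈ C, IsBodySym y) (rest : List Sym) :
    roundFST.run (.fC2 pd pk) (C ++ rest) =
      ((roundFST.run (.fC2 (pickRun pd pk C).1.1 (pickRun pd pk C).1.2) rest).1,
        (pickRun pd pk C).2 ++ (roundFST.run (.fC2 (pickRun pd pk C).1.1 (pickRun pd pk C).1.2) rest).2) := by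
  induction C generalizing pd pk with
  | nil => simp [pickRun]
  | cons y C ih =>
    have hy := hC y (by simp)
    have ih' := fun pd pk => ih pd pk (fun x hx => hC x (by simp [hx]))
    cases y with
    | lit s pol => cases s <;> cases pd <;> simp [pickRun, step, ih']
    | bar => cases pd <;> simp [pickRun, step, ih']
    | bit b mk => cases pd <;> simp [pickRun, step, ih']
    | flg ne => cases pd <;> simp [pickRun, step, ih']
    | _ => simp [IsBodySym] at hy

/-- **A `fin` round on a segment** with full copies: the original is deleted and the two copies
become segments with a picked pivot. [folklore] -/
theorem run_finSeg (pk : Bool) (s : List Sym) (hs : ∀ y ∈ s, IsBodySym y) (k : ℕ)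
    (hk : s.length ≤ k) (rest : List Sym) :
    roundFST.run (.fDel pk) (segTailK k s ++ rest) =
      let r₁ := pickRun false pk (corrStr false s)
      let r₂ := pickRun false r₁.1.2 (corrStr true s)
      ((roundFST.run (.fC2 r₂.1.1 r₂.1.2) rest).1,
        Sym.seg :: Sym.cur :: (r₁.2 ++ Sym.cpy1 :: Sym.cpy2 :: Sym.seg :: Sym.cur ::
          (r₂.2 ++ (roundFST.run (.fC2 r₂.1.1 r₂.1.2) rest).2))) := by
  have h1 : (corrStr false s).take k = corrStr false s := List.take_of_length_le (by simpa using hk)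
  have h1' : (corrStr true s).take k = corrStr true s := List.take_of_length_le (by simpa using hk)
  have h2 : s.drop k = [] := List.drop_eq_nil_iff.2 hk
  simp only [segTailK, List.take_of_length_le hk, h1, h1', h2, List.nil_append, List.append_assoc,
    List.cons_append]
  rw [run_fDel_body pk s hs]
  simp only [FST.run_cons, roundFST_step, step, List.nil_append, List.cons_append]
  rw [run_fC1 false pk _ (isBodySym_corrStr false s hs), run_fC2 false _ _ (isBodySym_corrStr true s hs)]

/-- Effect of a `fin` round on the segments, threading the picked flag. [folklore] -/
def finSegs : Bool → List (List Sym) → Bool × List (List Sym)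
  | pk, [] => (pk, [])
  | pk, s :: ss =>
      let r₁ := pickRun false pk (corrStr false s)
      let r₂ := pickRun false r₁.1.2 (corrStr true s)
      ((finSegs r₂.1.2 ss).1, r₁.2 :: r₂.2 :: (finSegs r₂.1.2 ss).2)

/-- All segments of a `fin` round, entered at a boundary in state `fC2`. [folklore] -/
theorem run_finSegs (k : ℕ) (ss : List (List Sym))
    (h : ∀ s ∈ ss, (∀ y ∈ s, IsBodySym y) ∧ s.length ≤ k) (pd pk : Bool) :
    roundFST.run (.fC2 pd pk) (ss.flatMap (fun s => Sym.seg :: segTailK k s) ++ [Sym.stop]) =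
      (.fDel (finSegs pk ss).1,
        Sym.cpy1 :: Sym.cpy2 :: ((finSegs pk ss).2.flatMap segStrF ++ [Sym.stop])) := by
  induction ss generalizing pd pk with
  | nil => simp [finSegs, step]
  | cons s ss ih =>
    obtain ⟨hs, hk⟩ := h s (by simp)
    have ih' := fun pd pk => ih (fun s' hs' => h s' (by simp [hs'])) pd pk
    simp only [List.flatMap_cons, List.cons_append, List.append_assoc, FST.run_cons, roundFST_step,
      step]
    rw [run_finSeg pk s hs k hk (List.flatMap (fun s => Sym.seg :: segTailK k s) ss ++ [Sym.stop])]
    simp only []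
    rw [ih']
    simp [finSegs, segStrF]

/-- **The `fin` round.** [folklore] -/
theorem F_fin (k : ℕ) (ss : List (List Sym))
    (h : ∀ s ∈ ss, (∀ y ∈ s, IsBodySym y) ∧ s.length ≤ k) :
    F (copyStrF .fin k ss) =
      plainStrF (if (finSegs false ss).1 then .cmp else .done) (finSegs false ss).2 := by
  cases ss with
  | nil => simp only [copyStrF, List.flatMap_nil, List.nil_append]; decide
  | cons s ss =>
    obtain ⟨hs, hk⟩ := h s (by simp)
    have h2 := fun pd pk => run_finSegs k ss (fun s' hs' => h s' (by simp [hs'])) pd pk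
    simp only [F_eq, copyStrF, List.flatMap_cons, List.cons_append, List.append_assoc, FST.run_cons,
      roundFST_step, step, List.nil_append]
    rw [run_finSeg false s hs k hk (List.flatMap (fun s => Sym.seg :: segTailK k s) ss ++ [Sym.stop])]
    simp only []
    rw [h2]
    simp [front, finSegs, plainStrF, segStrF]

/-! ### The `done` round -/

/-- In state `dn` everything passes. [folklore] -/
theorem run_dn (w : List Sym) : roundFST.run .dn w = (.dn, w) := by
  induction w with
  | nil => rfl
  | cons y w ih => simp [step, ih]

/-- **The `done` round is the identity.** [folklore] -/
theorem F_done (w : List Sym) : F (Sym.hdr .done :: w) = Sym.hdr .done :: w := by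
  simp [F_eq, step, run_dn, front]

/-! ## Canonical bodies of a clause list under a partial assignment -/

section Canonical

open _root_.Computability

/-- Literals `(variable index, polarity)`. [folklore] -/
abbrev Lit := ℕ × Bool

/-- Partial assignments. [folklore] -/
abbrev Assg := ℕ → Option Bool

/-- Unmarked bits. [folklore] -/
def unmarked (l : List Bool) : List (Bool × Bool) := l.map fun b => (b, false)

/-- Bits with the first `j` marked. [folklore] -/
def markPrefix (j : ℕ) (l : List Bool) : List (Bool × Bool) :=
  (l.take j).map (fun b => (b, true)) ++ (l.drop j).map (fun b => (b, false))

/-- Marking a prefix of length `0` marks nothing. [folklore] -/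
@[simp] theorem markPrefix_zero (l : List Bool) : markPrefix 0 l = unmarked l := by
  simp [markPrefix, unmarked]

/-- `unmarked` preserves the length. [folklore] -/
@[simp] theorem length_unmarked (l : List Bool) : (unmarked l).length = l.length := by simp [unmarked]

/-- `markPrefix` preserves the length. [folklore] -/
@[simp] theorem length_markPrefix (j : ℕ) (l : List Bool) : (markPrefix j l).length = l.length := by
  simp only [markPrefix, List.length_append, List.length_map, List.length_take, List.length_drop]
  omega

/-- The general threaded cell constructor: assigned literals get their value; the first
unassigned literal (flag `pd = false`) becomes the pivot, later ones are `u`-cells with bits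
`bitsF` and flag `neF`. [folklore] -/
def cellG (ρ : Assg) (neF : ℕ → Bool) (bitsF : ℕ → List (Bool × Bool)) (pd : Bool) (l : Lit) :
    Bool × Cell :=
  match ρ l.1 with
  | some v => (pd, ⟨.a v, l.2, unmarked (encodeNat l.1), false⟩)
  | none => (true, ⟨if pd then .u else .p, l.2, bitsF l.1, if pd then neF l.1 else false⟩)

/-- Threaded over a clause. [folklore] -/
def cellsG (ρ : Assg) (neF : ℕ → Bool) (bitsF : ℕ → List (Bool × Bool)) : Bool → List Lit → Bool × List Cell
  | pd, [] => (pd, [])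
  | pd, l :: ls =>
      ((cellsG ρ neF bitsF (cellG ρ neF bitsF pd l).1 ls).1,
        (cellG ρ neF bitsF pd l).2 :: (cellsG ρ neF bitsF (cellG ρ neF bitsF pd l).1 ls).2)

/-- Threaded over the clause list. [folklore] -/
def bodyG (ρ : Assg) (neF : ℕ → Bool) (bitsF : ℕ → List (Bool × Bool)) : Bool → List (List Lit) → Bool × Body
  | pd, [] => (pd, [])
  | pd, cl :: cs =>
      ((bodyG ρ neF bitsF (cellsG ρ neF bitsF pd cl).1 cs).1,
        (cellsG ρ neF bitsF pd cl).2 :: (bodyG ρ neF bitsF (cellsG ρ neF bitsF pd cl).1 cs).2)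

/-- The canonical body of `cs` under `ρ`: the state at the start of a pivot cycle. [folklore] -/
def canon (ρ : Assg) (cs : List (List Lit)) : Body :=
  (bodyG ρ (fun _ => false) (fun i => unmarked (encodeNat i)) false cs).2

/-- Flags of `u`-cells after `j` comparison rounds with pivot variable `x`. [folklore] -/
def neJ (x j : ℕ) (i : ℕ) : Bool := decide ((encodeNat i).take j ≠ (encodeNat x).take j)

/-- Bits after `j` comparison rounds. [folklore] -/
def bitsJ (j i : ℕ) : List (Bool × Bool) := markPrefix j (encodeNat i)

/-- Flags of `u`-cells after the exhaustion round with pivot variable `x`. [folklore] -/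
def neX (x : ℕ) (i : ℕ) : Bool := decide (encodeNat i ≠ encodeNat x)

/-- The body after `j` comparison rounds of the cycle with pivot variable `x`. [folklore] -/
def bodyJ (ρ : Assg) (x j : ℕ) (cs : List (List Lit)) : Body :=
  (bodyG ρ (neJ x j) (bitsJ j) false cs).2

/-- The body after the exhaustion round of the cycle with pivot variable `x`. [folklore] -/
def bodyX (ρ : Assg) (x : ℕ) (cs : List (List Lit)) : Body :=
  (bodyG ρ (neX x) (bitsJ (encodeNat x).length) false cs).2

/-- Before the first comparison round the body is the canonical body. [folklore] -/
theorem bodyJ_zero (ρ : Assg) (x : ℕ) (cs : List (List Lit)) : bodyJ ρ x 0 cs = canon ρ cs := by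
  have h1 : neJ x 0 = fun _ => false := by funext i; simp [neJ]
  have h2 : bitsJ 0 = fun i => unmarked (encodeNat i) := by funext i; simp [bitsJ]
  rw [bodyJ, h1, h2, canon]

/-! ### Flat strings of threaded bodies -/

/-- All symbols of a body string are body symbols. [folklore] -/
theorem isBodySym_bodyStr (B : Body) : ∀ y ∈ bodyStr B, IsBodySym y := by
  intro y hy
  simp only [bodyStr, List.mem_flatMap, clauseStr, List.mem_cons, cellStr, bitsStr, List.mem_append,
    List.mem_map] at hy
  obtain ⟨cl, -, rfl | ⟨c, -, rfl | ⟨q, -, rfl⟩ | h⟩⟩ := hy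
  · trivial
  · trivial
  · trivial
  · simp only [List.not_mem_nil, or_false] at h
    subst h; trivial

/-- The length of the string of a threaded body depends only on the clause list. [folklore] -/
def litsLen (cs : List (List Lit)) : ℕ :=
  (cs.map fun cl => 1 + (cl.map fun l => (encodeNat l.1).length + 2).sum).sum

/-- Length of a cell string. [folklore] -/
theorem length_cellStr (c : Cell) : (cellStr c).length = c.bits.length + 2 := by
  simp [cellStr, bitsStr]

/-- Length of the string of threaded cells. [folklore] -/
theorem length_cellsG (ρ : Assg) (neF : ℕ → Bool) (bitsF : ℕ → List (Bool × Bool))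
    (hb : ∀ i, (bitsF i).length = (encodeNat i).length) (pd : Bool) (cl : List Lit) :
    ((cellsG ρ neF bitsF pd cl).2.flatMap cellStr).length = (cl.map fun l => (encodeNat l.1).length + 2).sum := by
  induction cl generalizing pd with
  | nil => simp [cellsG]
  | cons l ls ih =>
    simp only [cellsG, List.flatMap_cons, List.length_append, ih, List.map_cons, List.sum_cons, length_cellStr]
    congr 1
    unfold cellG
    cases ρ l.1 <;> simp [hb]

/-- Length of the string of a threaded body. [folklore] -/
theorem length_bodyG (ρ : Assg) (neF : ℕ → Bool) (bitsF : ℕ → List (Bool × Bool))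
    (hb : ∀ i, (bitsF i).length = (encodeNat i).length) (pd : Bool) (cs : List (List Lit)) :
    (bodyStr (bodyG ρ neF bitsF pd cs).2).length = litsLen cs := by
  induction cs generalizing pd with
  | nil => simp [bodyG, bodyStr, litsLen]
  | cons cl cs ih =>
    simp only [bodyStr, litsLen] at ih ⊢
    simp [bodyG, clauseStr, length_cellsG ρ neF bitsF hb, ih]
    ring

/-- Length of the canonical body string. [folklore] -/
theorem length_canon (ρ : Assg) (cs : List (List Lit)) : (bodyStr (canon ρ cs)).length = litsLen cs :=
  length_bodyG ρ _ _ (fun i => by simp) false cs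

/-- Length of the body string after `j` comparison rounds. [folklore] -/
theorem length_bodyJ (ρ : Assg) (x j : ℕ) (cs : List (List Lit)) : (bodyStr (bodyJ ρ x j cs)).length = litsLen cs :=
  length_bodyG ρ _ _ (fun i => by simp [bitsJ]) false cs

/-- Length of the body string after the exhaustion round. [folklore] -/
theorem length_bodyX (ρ : Assg) (x : ℕ) (cs : List (List Lit)) : (bodyStr (bodyX ρ x cs)).length = litsLen cs :=
  length_bodyG ρ _ _ (fun i => by simp [bitsJ]) false cs

/-! ### Assigning the pivot variable (the correction written into the copies) -/

/-- The cell written into the copy for value `v`. [folklore] -/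
def assignCell (v : Bool) (c : Cell) : Cell :=
  ⟨newSt v c.st c.ne, c.pol, c.bits.map (fun q => (q.1, false)), false⟩

/-- The body written into the copy for value `v`. [folklore] -/
def assign (v : Bool) (B : Body) : Body := B.map fun cl => cl.map (assignCell v)

/-- The look-ahead flag across a bit string is the cell's trailing flag. [folklore] -/
theorem neAhead_bitsStr (bits : List (Bool × Bool)) (ne : Bool) (rest : List Sym) :
    neAhead (bitsStr bits ++ Sym.flg ne :: rest) = ne := by
  induction bits with
  | nil => rfl
  | cons q bits ih => simpa [bitsStr, neAhead] using ih

/-- Correction of a bit string: all marks are cleared. [folklore] -/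
theorem corrStr_bitsStr (v : Bool) (bits : List (Bool × Bool)) (rest : List Sym) :
    corrStr v (bitsStr bits ++ rest) = bitsStr (bits.map fun q => (q.1, false)) ++ corrStr v rest := by
  induction bits with
  | nil => rfl
  | cons q bits ih => simp [bitsStr, corrStr, corr] at ih ⊢; exact ih

/-- Correction of a cell string is the string of the assigned cell. [folklore] -/
theorem corrStr_cellStr (v : Bool) (c : Cell) (rest : List Sym) :
    corrStr v (cellStr c ++ rest) = cellStr (assignCell v c) ++ corrStr v rest := by
  simp only [cellStr, List.cons_append, List.append_assoc, corrStr, corr, neAhead_bitsStr,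
    corrStr_bitsStr, List.nil_append, assignCell]

/-- Correction of the cells of a clause. [folklore] -/
theorem corrStr_cells (v : Bool) (cl : List Cell) (rest : List Sym) :
    corrStr v (cl.flatMap cellStr ++ rest) = (cl.map (assignCell v)).flatMap cellStr ++ corrStr v rest := by
  induction cl with
  | nil => rfl
  | cons c cl ih => simp only [List.flatMap_cons, List.append_assoc, corrStr_cellStr, ih, List.map_cons]

/-- **The corrected copy of a body string is the string of the assigned body.** [folklore] -/
theorem corrStr_bodyStr (v : Bool) (B : Body) : corrStr v (bodyStr B) = bodyStr (assign v B) := by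
  induction B with
  | nil => rfl
  | cons cl B ih =>
    simp only [bodyStr, List.flatMap_cons, clauseStr, List.cons_append, corrStr, corr, assign,
      List.map_cons] at ih ⊢
    rw [corrStr_cells, ih]

/-! ### Picking the pivot -/

/-- Pick on a cell. [folklore] -/
def pickCell : Bool → Cell → Bool × Cell
  | false, c => if c.st = .u then (true, {c with st := .p}) else (false, c)
  | true, c => (true, c)

/-- Pick, threaded over cells. [folklore] -/
def pickCells : Bool → List Cell → Bool × List Cell
  | pd, [] => (pd, [])
  | pd, c :: cl => ((pickCells (pickCell pd c).1 cl).1, (pickCell pd c).2 :: (pickCells (pickCell pd c).1 cl).2)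

/-- Pick, threaded over a body. [folklore] -/
def pickBody : Bool → Body → Bool × Body
  | pd, [] => (pd, [])
  | pd, cl :: B => ((pickBody (pickCells pd cl).1 B).1, (pickCells pd cl).2 :: (pickBody (pickCells pd cl).1 B).2)

/-- Once the pivot has been picked, `pickCells` is the identity. [folklore] -/
@[simp] theorem pickCells_true (cl : List Cell) : pickCells true cl = (true, cl) := by
  induction cl with
  | nil => rfl
  | cons c cl ih => simp [pickCells, pickCell, ih]

/-- Once the pivot has been picked, `pickBody` is the identity. [folklore] -/
@[simp] theorem pickBody_true (B : Body) : pickBody true B = (true, B) := by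
  induction B with
  | nil => rfl
  | cons cl B ih => simp [pickBody, ih]

/-- `pickRun` copies bit strings. [folklore] -/
theorem pickRun_bitsStr (pd pk : Bool) (bits : List (Bool × Bool)) (rest : List Sym) :
    pickRun pd pk (bitsStr bits ++ rest) = ((pickRun pd pk rest).1, bitsStr bits ++ (pickRun pd pk rest).2) := by
  induction bits with
  | nil => rfl
  | cons q bits ih => cases pd <;> cases pk <;> simp_all [bitsStr, pickRun]

/-- `pickRun` on a cell string is `pickCell`. [folklore] -/
theorem pickRun_cellStr (pd pk : Bool) (c : Cell) (rest : List Sym) :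
    pickRun pd pk (cellStr c ++ rest) =
      ((pickRun (pickCell pd c).1 (pk || ((pickCell pd c).1 && !pd)) rest).1,
        cellStr (pickCell pd c).2 ++ (pickRun (pickCell pd c).1 (pk || ((pickCell pd c).1 && !pd)) rest).2) := by
  obtain ⟨st, pol, bits, ne⟩ := c
  cases pd <;> cases st <;> cases pk <;> simp [cellStr, pickRun, pickCell, pickRun_bitsStr]

/-- `pickRun` on the cells of a clause is `pickCells`. [folklore] -/
theorem pickRun_cells (pd pk : Bool) (cl : List Cell) (rest : List Sym) :
    pickRun pd pk (cl.flatMap cellStr ++ rest) =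
      ((pickRun (pickCells pd cl).1 (pk || ((pickCells pd cl).1 && !pd)) rest).1,
        (pickCells pd cl).2.flatMap cellStr ++
          (pickRun (pickCells pd cl).1 (pk || ((pickCells pd cl).1 && !pd)) rest).2) := by
  induction cl generalizing pd pk with
  | nil => cases pd <;> simp [pickCells]
  | cons c cl ih =>
    simp only [List.flatMap_cons, List.append_assoc, pickRun_cellStr, ih, pickCells]
    obtain ⟨st, pol, bits, ne⟩ := c
    cases pd <;> cases st <;> cases pk <;> simp [pickCell]

/-- **Picking on a body string is the string of the picked body**, with the flags
`(picked, pk || newly picked)`. [folklore] -/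
theorem pickRun_bodyStr (pd pk : Bool) (B : Body) :
    pickRun pd pk (bodyStr B) = (((pickBody pd B).1, pk || ((pickBody pd B).1 && !pd)), bodyStr (pickBody pd B).2) := by
  induction B generalizing pd pk with
  | nil => cases pd <;> cases pk <;> simp [bodyStr, pickRun, pickBody]
  | cons cl B ih =>
    simp only [bodyStr, List.flatMap_cons, clauseStr, List.cons_append] at ih ⊢
    have hbar : ∀ pd pk rest, pickRun pd pk (Sym.bar :: rest) = ((pickRun pd pk rest).1, Sym.bar :: (pickRun pd pk rest).2) := by
      intro pd pk rest; cases pd <;> simp [pickRun]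
    rw [hbar, pickRun_cells, ih]
    simp only [pickBody]
    cases pd
    · cases pk <;> cases (pickCells false cl).1 <;> simp [clauseStr]
    · cases pk <;> simp [clauseStr]

/-! ### The unpicked body and the effect of picking on threaded bodies -/

/-- The unpicked body: all unassigned literals are `u`-cells. [folklore] -/
def base (ρ : Assg) (cs : List (List Lit)) : Body :=
  (bodyG ρ (fun _ => false) (fun i => unmarked (encodeNat i)) true cs).2

/-- Threading with the pivot flag already set does not change the flag. [folklore] -/
@[simp] theorem cellsG_true_fst (ρ : Assg) (neF : ℕ → Bool) (bitsF : ℕ → List (Bool × Bool)) (cl : List Lit) :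
    (cellsG ρ neF bitsF true cl).1 = true := by
  induction cl with
  | nil => rfl
  | cons l ls ih =>
    simp only [cellsG]
    unfold cellG
    cases ρ l.1 <;> simp [ih]

/-- Picking the pivot in base cells yields the threaded cells. [folklore] -/
theorem pickCells_cellsG (ρ : Assg) (pd : Bool) (cl : List Lit) :
    pickCells pd (cellsG ρ (fun _ => false) (fun i => unmarked (encodeNat i)) true cl).2 =
      cellsG ρ (fun _ => false) (fun i => unmarked (encodeNat i)) pd cl := by
  induction cl generalizing pd with
  | nil => simp [cellsG, pickCells]
  | cons l ls ih =>
    simp only [cellsG, pickCells]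
    unfold cellG
    cases h : ρ l.1 <;> cases pd <;> simp [pickCell, ih]

/-- Picking the pivot in the base body yields the threaded body. [folklore] -/
theorem pickBody_base (ρ : Assg) (pd : Bool) (cs : List (List Lit)) :
    pickBody pd (base ρ cs) = bodyG ρ (fun _ => false) (fun i => unmarked (encodeNat i)) pd cs := by
  unfold base
  induction cs generalizing pd with
  | nil => simp [bodyG, pickBody]
  | cons cl cs ih =>
    simp only [bodyG, pickBody, pickCells_cellsG, cellsG_true_fst, ih]

/-- Picking on the unpicked body gives the canonical body. [folklore] -/
theorem pickBody_base_false (ρ : Assg) (cs : List (List Lit)) : (pickBody false (base ρ cs)).2 = canon ρ cs := by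
  rw [pickBody_base]; rfl

/-! ### Marked prefixes under `markFirst` -/

/-- `unmarked` of the empty list. [folklore] -/
@[simp] theorem unmarked_nil : unmarked [] = [] := rfl

/-- `unmarked` of a cons. [folklore] -/
@[simp] theorem unmarked_cons (b : Bool) (l : List Bool) : unmarked (b :: l) = (b, false) :: unmarked l := rfl

/-- `markPrefix` of the empty list. [folklore] -/
@[simp] theorem markPrefix_nil (j : ℕ) : markPrefix j [] = [] := by simp [markPrefix]

/-- `markPrefix (j+1)` marks the head and `j` more bits. [folklore] -/
@[simp] theorem markPrefix_succ_cons (j : ℕ) (b : Bool) (l : List Bool) :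
    markPrefix (j + 1) (b :: l) = (b, true) :: markPrefix j l := by
  simp [markPrefix]

/-- Marking at least `length` bits marks everything. [folklore] -/
theorem markPrefix_of_length_le {j : ℕ} {l : List Bool} (h : l.length ≤ j) :
    markPrefix j l = l.map (fun b => (b, true)) := by
  simp [markPrefix, List.take_of_length_le h, List.drop_eq_nil_iff.2 h]

/-- `markFirst` on a marked prefix finds the `j`-th bit (if any) and extends the prefix. [folklore] -/
theorem markFirst_markPrefix (j : ℕ) (l : List Bool) :
    markFirst (markPrefix j l) = (l[j]?, markPrefix (j + 1) l) := by
  induction l generalizing j with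
  | nil => simp [markFirst]
  | cons b l ih =>
    cases j with
    | zero => simp [markFirst]
    | succ j => simp [markFirst, ih]

/-- A marked prefix has an unmarked bit iff it is a proper prefix. [folklore] -/
theorem hasUnmarked_markPrefix (j : ℕ) (l : List Bool) :
    hasUnmarked (markPrefix j l) = decide (j < l.length) := by
  induction l generalizing j with
  | nil => simp [hasUnmarked]
  | cons b l ih =>
    cases j with
    | zero => simp [hasUnmarked]
    | succ j => simpa [hasUnmarked] using ih j

/-- Clearing the marks of `markPrefix j l` gives `unmarked l`. [folklore] -/
theorem unmark_markPrefix (j : ℕ) (l : List Bool) :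
    (markPrefix j l).map (fun q => (q.1, false)) = unmarked l := by
  induction l generalizing j with
  | nil => simp
  | cons b l ih =>
    cases j with
    | zero => simp [unmarked]
    | succ j => simp [ih]

/-- Clearing the marks of an unmarked list changes nothing. [folklore] -/
@[simp] theorem unmark_unmarked (l : List Bool) : (unmarked l).map (fun q => (q.1, false)) = unmarked l := by
  simp [unmarked]

/-! ### Prefix comparisons, one bit at a time -/

/-- `mis pb r` says that the comparison result `r` is not `some pb`. [folklore] -/
theorem mis_eq (pb : Bool) (r : Option Bool) : mis pb r = decide (r ≠ some pb) := by
  cases r with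
  | none => simp [mis]
  | some c => cases c <;> cases pb <;> simp [mis]

/-- Extending a prefix comparison by one bit (`a` = pivot index, `j < |a|`). [folklore] -/
theorem take_succ_eq_iff (a b : List Bool) (j : ℕ) (hj : j < a.length) :
    b.take (j + 1) = a.take (j + 1) ↔ b.take j = a.take j ∧ b[j]? = some a[j] := by
  constructor
  · intro h
    refine ⟨?_, ?_⟩
    · have := congrArg (List.take j) h
      simpa [List.take_take] using this
    · have := congrArg (fun l => l[j]?) h
      simp only [List.getElem?_take, Nat.lt_succ_self, if_true] at this
      rw [this, List.getElem?_eq_getElem hj]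
  · rintro ⟨h1, h2⟩
    rw [List.take_add_one, List.take_add_one, h1, h2, List.getElem?_eq_getElem hj]

/-- Extending a prefix comparison by one bit, in Boolean form. [folklore] -/
theorem take_succ_ne (a b : List Bool) (j : ℕ) (hj : j < a.length) :
    decide (b.take (j + 1) ≠ a.take (j + 1)) = (decide (b.take j ≠ a.take j) || mis a[j] b[j]?) := by
  rw [mis_eq]
  by_cases h1 : b.take j = a.take j <;> by_cases h2 : b[j]? = some a[j] <;>
    simp [take_succ_eq_iff a b j hj, h1, h2]

/-- Closing a prefix comparison at the end of the pivot index `a`: the indices differ iff the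
prefixes of length `|a|` differ or `b` is longer. [folklore] -/
theorem ne_iff_take_length (a b : List Bool) :
    decide (b ≠ a) = (decide (b.take a.length ≠ a.take a.length) || decide (a.length < b.length)) := by
  rw [List.take_length]
  rcases le_or_gt b.length a.length with h | h
  · rw [List.take_of_length_le h]
    simp [Nat.not_lt.2 h]
  · simp only [h, decide_true, Bool.or_true, decide_eq_true_eq]
    intro e; subst e; exact lt_irrefl _ h

/-! ### The first unassigned literal -/

/-- `FirstNone ρ x ls`: the first literal of `ls` unassigned under `ρ` (if any) has index `x`. [folklore] -/
def FirstNone (ρ : Assg) (x : ℕ) : List Lit → Prop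
  | [] => True
  | l :: ls => match ρ l.1 with
    | none => l.1 = x
    | some _ => FirstNone ρ x ls

/-- Whether some literal is unassigned. [folklore] -/
def hasNone (ρ : Assg) (ls : List Lit) : Bool := ls.any fun l => (ρ l.1).isNone

/-- `FirstNone` over a concatenation. [folklore] -/
theorem firstNone_append (ρ : Assg) (x : ℕ) (l₁ l₂ : List Lit) :
    FirstNone ρ x (l₁ ++ l₂) ↔ FirstNone ρ x l₁ ∧ (hasNone ρ l₁ = false → FirstNone ρ x l₂) := by
  induction l₁ with
  | nil => simp [FirstNone, hasNone]
  | cons l ls ih =>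
    simp only [List.cons_append, FirstNone, hasNone, List.any_cons, Bool.or_eq_false_iff]
    cases ρ l.1 <;> simp [ih, hasNone]

/-- The flag after a clause. [folklore] -/
theorem cellsG_fst (ρ : Assg) (neF : ℕ → Bool) (bitsF : ℕ → List (Bool × Bool)) (pd : Bool) (cl : List Lit) :
    (cellsG ρ neF bitsF pd cl).1 = (pd || hasNone ρ cl) := by
  induction cl generalizing pd with
  | nil => simp [cellsG, hasNone]
  | cons l ls ih =>
    simp only [cellsG, ih, hasNone, List.any_cons]
    unfold cellG
    cases ρ l.1 <;> cases pd <;> simp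

/-! ### The comparison rounds on threaded bodies -/

section Cmp

variable (ρ : Assg) (x : ℕ)

/-- The transducer state between cells during an advancing comparison round. [folklore] -/
def cst (pb : Bool) (pd sn ex : Bool) : CSt := if pd then ⟨.carry (some pb), sn, ex⟩ else ⟨.pre, sn, ex⟩

/-- The transducer state between cells during the exhaustion round. [folklore] -/
def cstX (pd sn ex : Bool) : CSt := if pd then ⟨.carry none, sn, ex⟩ else ⟨.pre, sn, ex⟩

/-- `cmpCell` in a carry state on an assigned cell. [folklore] -/
theorem cmpCell_cst_a (pb pd sn ex v pol : Bool) (bits : List (Bool × Bool)) (ne : Bool) :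
    cmpCell (cst pb pd sn ex) ⟨.a v, pol, bits, ne⟩ = (cst pb pd sn ex, ⟨.a v, pol, bits, ne⟩) := by
  cases pd <;> simp [cst, cmpCell]

/-- `cmpCell` in a carry state on a pivot cell. [folklore] -/
theorem cmpCell_cst_p (pb sn ex pol : Bool) (bits bits' : List (Bool × Bool)) (ne : Bool)
    (h : markFirst bits = (some pb, bits')) :
    cmpCell (cst pb false sn ex) ⟨.p, pol, bits, ne⟩ = (cst pb true true ex, ⟨.p, pol, bits', ne⟩) := by
  simp [cst, cmpCell, h]

/-- `cmpCell` in a carry state on an unassigned cell. [folklore] -/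
theorem cmpCell_cst_u (pb sn ex pol : Bool) (bits bits' : List (Bool × Bool)) (r : Option Bool) (ne : Bool)
    (h : markFirst bits = (r, bits')) :
    cmpCell (cst pb true sn ex) ⟨.u, pol, bits, ne⟩ = (cst pb true sn ex, ⟨.u, pol, bits', ne || mis pb r⟩) := by
  simp [cst, cmpCell, h]

/-- `cmpCell` in the exhaustion carry state on an assigned cell. [folklore] -/
theorem cmpCell_cstX_a (pd sn ex v pol : Bool) (bits : List (Bool × Bool)) (ne : Bool) :
    cmpCell (cstX pd sn ex) ⟨.a v, pol, bits, ne⟩ = (cstX pd sn ex, ⟨.a v, pol, bits, ne⟩) := by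
  cases pd <;> simp [cstX, cmpCell]

/-- `cmpCell` in the exhaustion carry state on a pivot cell. [folklore] -/
theorem cmpCell_cstX_p (sn ex pol : Bool) (bits : List (Bool × Bool)) (ne : Bool)
    (h : markFirst bits = (none, bits)) :
    cmpCell (cstX false sn ex) ⟨.p, pol, bits, ne⟩ = (cstX true true true, ⟨.p, pol, bits, ne⟩) := by
  simp [cstX, cmpCell, h]

/-- `cmpCell` in the exhaustion carry state on an unassigned cell. [folklore] -/
theorem cmpCell_cstX_u (sn ex pol : Bool) (bits : List (Bool × Bool)) (ne : Bool) :
    cmpCell (cstX true sn ex) ⟨.u, pol, bits, ne⟩ = (cstX true sn ex, ⟨.u, pol, bits, ne || hasUnmarked bits⟩) := by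
  simp [cstX, cmpCell]

/-- `hasNone` of a cons. [folklore] -/
@[simp] theorem hasNone_cons (l : Lit) (ls : List Lit) : hasNone ρ (l :: ls) = ((ρ l.1).isNone || hasNone ρ ls) := by
  simp [hasNone]

/-- `hasNone` of the empty list. [folklore] -/
@[simp] theorem hasNone_nil : hasNone ρ [] = false := rfl

/-- **An advancing comparison round on a clause.** [folklore] -/
theorem cmpCells_adv (j : ℕ) (hj : j < (encodeNat x).length) (pd sn ex : Bool) (cl : List Lit)
    (hx : pd = false → FirstNone ρ x cl) :
    cmpCells (cst ((encodeNat x)[j]) pd sn ex) (cellsG ρ (neJ x j) (bitsJ j) pd cl).2 =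
      (cst ((encodeNat x)[j]) (pd || hasNone ρ cl) (sn || (!pd && hasNone ρ cl)) ex,
        (cellsG ρ (neJ x (j + 1)) (bitsJ (j + 1)) pd cl).2) := by
  induction cl generalizing pd sn with
  | nil => simp [cellsG, cmpCells]
  | cons l ls ih =>
    simp only [cellsG, cmpCells, hasNone_cons]
    unfold cellG
    cases h : ρ l.1 with
    | some v =>
      have hx' : pd = false → FirstNone ρ x ls := fun hpd => by
        have := hx hpd; simp only [FirstNone, h] at this; exact this
      simp only [cmpCell_cst_a, ih pd sn hx', Option.isNone_some, Bool.false_or]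
    | none =>
      cases pd
      · -- the pivot
        have hlx : l.1 = x := by have := hx rfl; simp only [FirstNone, h] at this; exact this
        have hm : markFirst (bitsJ j l.1) = (some (encodeNat x)[j], bitsJ (j + 1) l.1) := by
          rw [bitsJ, bitsJ, hlx, markFirst_markPrefix, List.getElem?_eq_getElem hj]
        simp only [Bool.false_eq_true, ↓reduceIte, cmpCell_cst_p _ _ _ _ _ _ _ hm,
          ih true true (fun h => Bool.noConfusion h), Option.isNone_none]
        simp
      · -- a `u`-cell
        have hm : markFirst (bitsJ j l.1) = ((encodeNat l.1)[j]?, bitsJ (j + 1) l.1) := by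
          rw [bitsJ, bitsJ, markFirst_markPrefix]
        simp only [↓reduceIte, cmpCell_cst_u _ _ _ _ _ _ _ _ hm, ih true sn (fun h => Bool.noConfusion h),
          Option.isNone_none, neJ]
        rw [take_succ_ne _ _ _ hj]
        simp

/-- **The exhaustion round on a clause.** [folklore] -/
theorem cmpCells_exh (pd sn ex : Bool) (cl : List Lit) (hx : pd = false → FirstNone ρ x cl) :
    cmpCells (cstX pd sn ex) (cellsG ρ (neJ x (encodeNat x).length) (bitsJ (encodeNat x).length) pd cl).2 =
      (cstX (pd || hasNone ρ cl) (sn || (!pd && hasNone ρ cl)) (ex || (!pd && hasNone ρ cl)),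
        (cellsG ρ (neX x) (bitsJ (encodeNat x).length) pd cl).2) := by
  induction cl generalizing pd sn ex with
  | nil => simp [cellsG, cmpCells]
  | cons l ls ih =>
    simp only [cellsG, cmpCells, hasNone_cons]
    unfold cellG
    cases h : ρ l.1 with
    | some v =>
      have hx' : pd = false → FirstNone ρ x ls := fun hpd => by
        have := hx hpd; simp only [FirstNone, h] at this; exact this
      simp only [cmpCell_cstX_a, ih pd sn ex hx', Option.isNone_some, Bool.false_or]
    | none =>
      cases pd
      · have hlx : l.1 = x := by have := hx rfl; simp only [FirstNone, h] at this; exact this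
        have hm : markFirst (bitsJ (encodeNat x).length l.1) = (none, bitsJ (encodeNat x).length l.1) := by
          rw [bitsJ, hlx, markFirst_markPrefix, List.getElem?_eq_none_iff.2 le_rfl,
            markPrefix_of_length_le le_rfl, markPrefix_of_length_le (Nat.le_succ _)]
        simp only [Bool.false_eq_true, ↓reduceIte, cmpCell_cstX_p _ _ _ _ _ hm,
          ih true true true (fun h => Bool.noConfusion h), Option.isNone_none]
        simp
      · simp only [↓reduceIte, cmpCell_cstX_u, ih true sn ex (fun h => Bool.noConfusion h),
          Option.isNone_none, neJ, neX, bitsJ, hasUnmarked_markPrefix]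
        rw [ne_iff_take_length (encodeNat x) (encodeNat l.1)]
        simp

/-- `hasNone` over a concatenation. [folklore] -/
theorem hasNone_append (l₁ l₂ : List Lit) : hasNone ρ (l₁ ++ l₂) = (hasNone ρ l₁ || hasNone ρ l₂) := by
  simp [hasNone, List.any_append]

/-- The flag after a body. [folklore] -/
theorem bodyG_fst (neF : ℕ → Bool) (bitsF : ℕ → List (Bool × Bool)) (pd : Bool) (cs : List (List Lit)) :
    (bodyG ρ neF bitsF pd cs).1 = (pd || hasNone ρ cs.flatten) := by
  induction cs generalizing pd with
  | nil => simp [bodyG, hasNone]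
  | cons cl cs ih =>
    simp only [bodyG, ih, cellsG_fst, List.flatten_cons, hasNone_append, Bool.or_assoc]

/-- **An advancing comparison round on a body.** [folklore] -/
theorem cmpBody_adv (j : ℕ) (hj : j < (encodeNat x).length) (pd sn ex : Bool) (cs : List (List Lit))
    (hx : pd = false → FirstNone ρ x cs.flatten) :
    cmpBody (cst ((encodeNat x)[j]) pd sn ex) (bodyG ρ (neJ x j) (bitsJ j) pd cs).2 =
      (cst ((encodeNat x)[j]) (pd || hasNone ρ cs.flatten) (sn || (!pd && hasNone ρ cs.flatten)) ex,
        (bodyG ρ (neJ x (j + 1)) (bitsJ (j + 1)) pd cs).2) := by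
  induction cs generalizing pd sn with
  | nil => simp [bodyG, cmpBody]
  | cons cl cs ih =>
    have hx₁ : pd = false → FirstNone ρ x cl := fun h =>
      ((firstNone_append ρ x cl cs.flatten).1 (by simpa using hx h)).1
    have hx₂ : (pd || hasNone ρ cl) = false → FirstNone ρ x cs.flatten := fun h => by
      simp only [Bool.or_eq_false_iff] at h
      exact ((firstNone_append ρ x cl cs.flatten).1 (by simpa using hx h.1)).2 h.2
    simp only [bodyG, cmpBody, cmpCells_adv ρ x j hj pd sn ex cl hx₁, cellsG_fst, ih _ _ hx₂,
      List.flatten_cons, hasNone_append]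
    cases pd <;> cases sn <;> cases hasNone ρ cl <;> cases hasNone ρ cs.flatten <;> rfl

/-- **The exhaustion round on a body.** [folklore] -/
theorem cmpBody_exh (pd sn ex : Bool) (cs : List (List Lit)) (hx : pd = false → FirstNone ρ x cs.flatten) :
    cmpBody (cstX pd sn ex) (bodyG ρ (neJ x (encodeNat x).length) (bitsJ (encodeNat x).length) pd cs).2 =
      (cstX (pd || hasNone ρ cs.flatten) (sn || (!pd && hasNone ρ cs.flatten)) (ex || (!pd && hasNone ρ cs.flatten)),
        (bodyG ρ (neX x) (bitsJ (encodeNat x).length) pd cs).2) := by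
  induction cs generalizing pd sn ex with
  | nil => simp [bodyG, cmpBody]
  | cons cl cs ih =>
    have hx₁ : pd = false → FirstNone ρ x cl := fun h =>
      ((firstNone_append ρ x cl cs.flatten).1 (by simpa using hx h)).1
    have hx₂ : (pd || hasNone ρ cl) = false → FirstNone ρ x cs.flatten := fun h => by
      simp only [Bool.or_eq_false_iff] at h
      exact ((firstNone_append ρ x cl cs.flatten).1 (by simpa using hx h.1)).2 h.2
    simp only [bodyG, cmpBody, cmpCells_exh ρ x pd sn ex cl hx₁, cellsG_fst, ih _ _ _ hx₂,
      List.flatten_cons, hasNone_append]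
    cases pd <;> cases sn <;> cases ex <;> cases hasNone ρ cl <;> cases hasNone ρ cs.flatten <;> rfl

/-! ### Assigning the pivot: the copies are the unpicked bodies of the extended assignments -/

/-- Extending an assignment at the pivot variable. [folklore] -/
def upd (ρ : Assg) (x : ℕ) (v : Bool) : Assg := Function.update ρ x (some v)

/-- `Computability.encodeNat` is injective. [folklore] -/
theorem encodeNat_injective : Function.Injective encodeNat := fun a b h => by
  simpa using congrArg decodeNat h

/-- Assigning the pivot value in exhausted cells yields the canonical cells of the extended assignment. [folklore] -/
theorem assign_cellsX (v : Bool) (hρx : ρ x = none) (pd : Bool) (cl : List Lit)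
    (hx : pd = false → FirstNone ρ x cl) :
    ((cellsG ρ (neX x) (bitsJ (encodeNat x).length) pd cl).2).map (assignCell v) =
      (cellsG (upd ρ x v) (fun _ => false) (fun i => unmarked (encodeNat i)) true cl).2 := by
  induction cl generalizing pd with
  | nil => simp [cellsG]
  | cons l ls ih =>
    simp only [cellsG, List.map_cons]
    unfold cellG
    cases h : ρ l.1 with
    | some w =>
      have hne : l.1 ≠ x := fun e => by rw [e, hρx] at h; cases h
      have hx' : pd = false → FirstNone ρ x ls := fun hpd => by
        have := hx hpd; simp only [FirstNone, h] at this; exact this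
      have hu : upd ρ x v l.1 = some w := by rw [upd, Function.update_of_ne hne, h]
      simp [hu, assignCell, newSt, ih pd hx']
    | none =>
      cases pd
      · have hlx : l.1 = x := by have := hx rfl; simp only [FirstNone, h] at this; exact this
        have hu : upd ρ x v l.1 = some v := by rw [upd, hlx, Function.update_self]
        simp [hu, assignCell, newSt, bitsJ, unmark_markPrefix, ih true (fun h => Bool.noConfusion h)]
      · by_cases hlx : l.1 = x
        · have hu : upd ρ x v x = some v := by rw [upd, Function.update_self]
          simp [hu, assignCell, newSt, neX, bitsJ, hlx, unmark_markPrefix, ih true (fun h => Bool.noConfusion h)]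
        · have hu : upd ρ x v l.1 = none := by rw [upd, Function.update_of_ne hlx, h]
          have hne : encodeNat l.1 ≠ encodeNat x := fun e => hlx (encodeNat_injective e)
          simp [hu, assignCell, newSt, neX, bitsJ, hne, unmark_markPrefix, ih true (fun h => Bool.noConfusion h)]

/-- **The corrected copies of the exhausted body are the unpicked bodies of the two extended
assignments.** [folklore] -/
theorem assign_bodyX (v : Bool) (hρx : ρ x = none) (pd : Bool) (cs : List (List Lit))
    (hx : pd = false → FirstNone ρ x cs.flatten) :
    assign v (bodyG ρ (neX x) (bitsJ (encodeNat x).length) pd cs).2 =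
      (bodyG (upd ρ x v) (fun _ => false) (fun i => unmarked (encodeNat i)) true cs).2 := by
  induction cs generalizing pd with
  | nil => simp [bodyG, assign]
  | cons cl cs ih =>
    have hx₁ : pd = false → FirstNone ρ x cl := fun h =>
      ((firstNone_append ρ x cl cs.flatten).1 (by simpa using hx h)).1
    have hx₂ : (pd || hasNone ρ cl) = false → FirstNone ρ x cs.flatten := fun h => by
      simp only [Bool.or_eq_false_iff] at h
      exact ((firstNone_append ρ x cl cs.flatten).1 (by simpa using hx h.1)).2 h.2
    have ih' := ih _ hx₂
    simp only [assign] at ih' ⊢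
    simp only [bodyG, List.map_cons, assign_cellsX ρ x v hρx pd cl hx₁, cellsG_fst, Bool.true_or, ih']

/-- Assigning the pivot value in the exhausted body yields the canonical body of the extended assignment. [folklore] -/
theorem assign_bodyX' (v : Bool) (hρx : ρ x = none) (cs : List (List Lit)) (hx : FirstNone ρ x cs.flatten) :
    assign v (bodyX ρ x cs) = base (upd ρ x v) cs :=
  assign_bodyX ρ x v hρx false cs (fun _ => hx)

/-- If the first unassigned literal has variable `x` and some literal is unassigned then `x` is unassigned. [folklore] -/
theorem firstNone_none_of_hasNone (ls : List Lit) (h1 : FirstNone ρ x ls) (h2 : hasNone ρ ls = true) : ρ x = none := by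
  induction ls with
  | nil => simp at h2
  | cons l ls ih =>
    simp only [FirstNone] at h1
    simp only [hasNone_cons, Bool.or_eq_true, Option.isNone_iff_eq_none] at h2
    cases h : ρ l.1 with
    | none => rw [h] at h1; rw [← h1]; exact h
    | some w =>
      rw [h] at h1 h2
      exact ih h1 (by simpa using h2)

/-! ### Rounds on lists of canonical segments -/

variable (cs : List (List Lit))

/-- The advancing comparison round on all segments. [folklore] -/
theorem cmpSegs_adv (j : ℕ) (hj : j < (encodeNat x).length) (sn ex : Bool) (ρs : List Assg)
    (h : ∀ ρ ∈ ρs, FirstNone ρ x cs.flatten ∧ hasNone ρ cs.flatten = true) :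
    cmpSegs sn ex (ρs.map fun ρ => bodyJ ρ x j cs) =
      (((sn || !ρs.isEmpty), ex), ρs.map fun ρ => bodyJ ρ x (j + 1) cs) := by
  induction ρs generalizing sn with
  | nil => simp [cmpSegs]
  | cons ρ ρs ih =>
    obtain ⟨hx, hn⟩ := h ρ (by simp)
    have hb := cmpBody_adv ρ x j hj false sn ex cs (fun _ => hx)
    simp only [cst, Bool.false_eq_true, ↓reduceIte, hn, Bool.or_true, Bool.not_false,
      Bool.true_and] at hb
    rw [← bodyJ, ← bodyJ] at hb
    simp only [List.map_cons, cmpSegs, hb, ih true (fun ρ' h' => h ρ' (by simp [h'])),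
      List.isEmpty_cons, Bool.not_false, Bool.or_true, Bool.true_or]

/-- The exhaustion round on all segments. [folklore] -/
theorem cmpSegs_exh (sn ex : Bool) (ρs : List Assg)
    (h : ∀ ρ ∈ ρs, FirstNone ρ x cs.flatten ∧ hasNone ρ cs.flatten = true) :
    cmpSegs sn ex (ρs.map fun ρ => bodyJ ρ x (encodeNat x).length cs) =
      (((sn || !ρs.isEmpty), (ex || !ρs.isEmpty)), ρs.map fun ρ => bodyX ρ x cs) := by
  induction ρs generalizing sn ex with
  | nil => simp [cmpSegs]
  | cons ρ ρs ih =>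
    obtain ⟨hx, hn⟩ := h ρ (by simp)
    have hb := cmpBody_exh ρ x false sn ex cs (fun _ => hx)
    simp only [cstX, Bool.false_eq_true, ↓reduceIte, hn, Bool.or_true, Bool.not_false,
      Bool.true_and] at hb
    rw [← bodyJ, ← bodyX] at hb
    simp only [List.map_cons, cmpSegs, hb, ih true true (fun ρ' h' => h ρ' (by simp [h'])),
      List.isEmpty_cons, Bool.not_false, Bool.or_true, Bool.true_or]

/-- **The advancing comparison round** on the plain layout of canonical segments. [folklore] -/
theorem F_cmp_adv (j : ℕ) (hj : j < (encodeNat x).length) (ρs : List Assg) (hne : ρs ≠ [])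
    (h : ∀ ρ ∈ ρs, FirstNone ρ x cs.flatten ∧ hasNone ρ cs.flatten = true) :
    F (plainStrF .cmp (ρs.map fun ρ => bodyStr (bodyJ ρ x j cs))) =
      plainStrF .cmp (ρs.map fun ρ => bodyStr (bodyJ ρ x (j + 1) cs)) := by
  have := F_cmp (ρs.map fun ρ => bodyJ ρ x j cs)
  rw [List.map_map] at this
  rw [Function.comp_def] at this
  rw [this, cmpSegs_adv x cs j hj false false ρs h]
  cases ρs with
  | nil => exact absurd rfl hne
  | cons ρ ρs => simp [cmpNext, List.map_map, Function.comp_def]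

/-- **The exhaustion round** on the plain layout of canonical segments: the mode becomes `copy`. [folklore] -/
theorem F_cmp_exh (ρs : List Assg) (hne : ρs ≠ [])
    (h : ∀ ρ ∈ ρs, FirstNone ρ x cs.flatten ∧ hasNone ρ cs.flatten = true) :
    F (plainStrF .cmp (ρs.map fun ρ => bodyStr (bodyJ ρ x (encodeNat x).length cs))) =
      plainStrF .copy (ρs.map fun ρ => bodyStr (bodyX ρ x cs)) := by
  have := F_cmp (ρs.map fun ρ => bodyJ ρ x (encodeNat x).length cs)
  rw [List.map_map, Function.comp_def] at this
  rw [this, cmpSegs_exh x cs false false ρs h]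
  cases ρs with
  | nil => exact absurd rfl hne
  | cons ρ ρs => simp [cmpNext, List.map_map, Function.comp_def]

/-- The `fin` round on the exhausted segments: the new segments are the canonical bodies of the
extended assignments. [folklore] -/
theorem finSegs_X (ρs : List Assg) (hN : Bool)
    (h : ∀ ρ ∈ ρs, FirstNone ρ x cs.flatten ∧ hasNone ρ cs.flatten = true)
    (h' : ∀ ρ ∈ ρs, ∀ v, hasNone (upd ρ x v) cs.flatten = hN) (pk : Bool) :
    finSegs pk (ρs.map fun ρ => bodyStr (bodyX ρ x cs)) =
      ((pk || (!ρs.isEmpty && hN)),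
        (ρs.flatMap fun ρ => [upd ρ x false, upd ρ x true]).map fun ρ => bodyStr (canon ρ cs)) := by
  induction ρs generalizing pk with
  | nil => simp [finSegs]
  | cons ρ ρs ih =>
    obtain ⟨hx, hn⟩ := h ρ (by simp)
    have hρx := firstNone_none_of_hasNone ρ x cs.flatten hx hn
    have key : ∀ v pk', pickRun false pk' (corrStr v (bodyStr (bodyX ρ x cs))) =
        ((hN, pk' || hN), bodyStr (canon (upd ρ x v) cs)) := by
      intro v pk'
      rw [corrStr_bodyStr, assign_bodyX' ρ x v hρx cs hx]
      rw [pickRun_bodyStr false pk' (base (upd ρ x v) cs), pickBody_base, bodyG_fst, h' ρ (by simp) v]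
      simp [canon]
    simp only [List.map_cons, finSegs, key, ih (fun ρ' h'' => h ρ' (by simp [h''])) (fun ρ' h'' => h' ρ' (by simp [h''])),
      List.flatMap_cons, List.isEmpty_cons]
    cases pk <;> cases hN <;> simp

/-! ### Lengths of the layouts -/

/-- Length of the plain layout of segments of common length `m`. [folklore] -/
theorem length_plainStrF (md : Mode) (ss : List (List Sym)) (m : ℕ) (hm : ∀ s ∈ ss, s.length = m) :
    (plainStrF md ss).length = 2 + ss.length * (m + 4) := by
  induction ss with
  | nil => simp [plainStrF]
  | cons s ss ih =>
    have ih' := ih (fun s' h => hm s' (by simp [h]))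
    simp only [plainStrF, List.length_cons, List.length_append, List.length_flatMap] at ih' ⊢
    simp only [List.map_cons, List.sum_cons, segStrF, List.length_cons, List.length_append, hm s (by simp)]
    simp only [segStrF, List.length_cons, List.length_append, List.length_nil] at ih' ⊢
    rw [Nat.succ_mul]
    omega

/-- Length bound for a segment tail during copying. [folklore] -/
theorem length_segTailK_le (k : ℕ) (s : List Sym) : (segTailK k s).length ≤ 3 * s.length + 3 := by
  simp only [segTailK, List.length_append, List.length_cons, List.length_take, List.length_drop, length_corrStr]
  have := Nat.min_le_right k s.length
  omega

/-- Length bound for the copy layout. [folklore] -/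
theorem length_copyStrF_le (md : Mode) (k : ℕ) (ss : List (List Sym)) (m : ℕ) (hm : ∀ s ∈ ss, s.length = m) :
    (copyStrF md k ss).length ≤ 2 + ss.length * (3 * m + 4) := by
  induction ss with
  | nil => simp [copyStrF]
  | cons s ss ih =>
    have ih' := ih (fun s' h => hm s' (by simp [h]))
    have hs := length_segTailK_le k s
    rw [hm s (by simp)] at hs
    simp only [copyStrF, List.flatMap_cons, List.cons_append, List.length_cons, List.length_append,
      List.append_assoc, List.length_nil] at ih' ⊢
    rw [Nat.succ_mul]
    omega

/-! ### One pivot cycle -/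

/-- **One pivot cycle.** From the plain `cmp` layout of the canonical segments of `ρs` (all
with the same unassigned literals, the first one having index `x`), after
`|encodeNat x| + litsLen cs + 3` rounds the string is the plain layout of the canonical segments
of the extended assignments `ρ[x ↦ false], ρ[x ↦ true]`, in mode `cmp` if some literal is
still unassigned and `done` otherwise; meanwhile the length never exceeds
`2 + 2 |ρs| (3 litsLen cs + 4)`. [folklore] -/
theorem cycle (ρs : List Assg) (hne : ρs ≠ []) (hN : Bool)
    (h : ∀ ρ ∈ ρs, FirstNone ρ x cs.flatten ∧ hasNone ρ cs.flatten = true)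
    (h' : ∀ ρ ∈ ρs, ∀ v, hasNone (upd ρ x v) cs.flatten = hN) :
    (F^[(encodeNat x).length + litsLen cs + 3] (plainStrF .cmp (ρs.map fun ρ => bodyStr (canon ρ cs))) =
      plainStrF (if hN then .cmp else .done)
        ((ρs.flatMap fun ρ => [upd ρ x false, upd ρ x true]).map fun ρ => bodyStr (canon ρ cs))) ∧
    ∀ i ≤ (encodeNat x).length + litsLen cs + 3,
      (F^[i] (plainStrF .cmp (ρs.map fun ρ => bodyStr (canon ρ cs)))).length ≤
        2 + 2 * ρs.length * (3 * litsLen cs + 4) := by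
  set nb := (encodeNat x).length with hnb
  set m := litsLen cs with hm
  set S₀ := plainStrF .cmp (ρs.map fun ρ => bodyStr (canon ρ cs)) with hS₀
  set ssX := ρs.map fun ρ => bodyStr (bodyX ρ x cs) with hssX
  -- stage A: comparison rounds
  have hA : ∀ j ≤ nb, F^[j] S₀ = plainStrF .cmp (ρs.map fun ρ => bodyStr (bodyJ ρ x j cs)) := by
    intro j hj
    induction j with
    | zero => simp [hS₀, bodyJ_zero]
    | succ j ih =>
      rw [Function.iterate_succ_apply', ih (by omega), F_cmp_adv x cs j (by omega) ρs hne h]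
  -- stage B: exhaustion round
  have hB : F^[nb + 1] S₀ = copyStrF .copy 0 ssX := by
    rw [Function.iterate_succ_apply', hA nb le_rfl, F_cmp_exh x cs ρs hne h, copyStrF_zero]
  -- the exhausted segments
  have hss : ∀ s ∈ ssX, (∀ y ∈ s, IsBodySym y) ∧ s.length = m := by
    intro s hs
    simp only [hssX, List.mem_map] at hs
    obtain ⟨ρ, -, rfl⟩ := hs
    exact ⟨isBodySym_bodyStr _, length_bodyX ρ x cs⟩
  have hssne : ssX ≠ [] := by simpa [hssX] using hne
  -- stage C: copy rounds
  have hC : ∀ k ≤ m, F^[nb + 1 + k] S₀ = copyStrF .copy k ssX := by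
    intro k hk
    induction k with
    | zero => simpa using hB
    | succ k ih =>
      rw [show nb + 1 + (k + 1) = (nb + 1 + k) + 1 by omega, Function.iterate_succ_apply', ih (by omega)]
      exact F_copy_lt k ssX (fun s hs => ⟨(hss s hs).1, by rw [(hss s hs).2]; omega⟩)
  -- stage D: end of copying
  have hD : F^[nb + m + 2] S₀ = copyStrF .fin m ssX := by
    rw [show nb + m + 2 = (nb + 1 + m) + 1 by omega, Function.iterate_succ_apply', hC m le_rfl]
    exact F_copy_ge m ssX hssne (fun s hs => ⟨(hss s hs).1, (hss s hs).2.le⟩)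
  -- stage E: the split
  have hE : F^[nb + m + 3] S₀ = plainStrF (if hN then .cmp else .done)
      ((ρs.flatMap fun ρ => [upd ρ x false, upd ρ x true]).map fun ρ => bodyStr (canon ρ cs)) := by
    rw [show nb + m + 3 = (nb + m + 2) + 1 by omega, Function.iterate_succ_apply', hD,
      F_fin m ssX (fun s hs => ⟨(hss s hs).1, (hss s hs).2.le⟩), finSegs_X x cs ρs hN h h' false]
    cases ρs with
    | nil => exact absurd rfl hne
    | cons ρ ρs => simp
  refine ⟨hE, fun i hi => ?_⟩
  -- lengths
  have hlenC : ∀ ρ, (bodyStr (canon ρ cs)).length = m := fun ρ => length_canon ρ cs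
  have hN1 : 1 ≤ ρs.length := by
    cases ρs with
    | nil => exact absurd rfl hne
    | cons _ _ => simp
  rcases Nat.lt_or_ge i (nb + 1) with hi1 | hi1
  · rw [hA i (by omega), length_plainStrF _ _ m (by
      intro s hs; simp only [List.mem_map] at hs; obtain ⟨ρ, -, rfl⟩ := hs; exact length_bodyJ ρ x i cs)]
    simp only [List.length_map]
    nlinarith
  rcases Nat.lt_or_ge i (nb + m + 2) with hi2 | hi2
  · obtain ⟨k, hk, rfl⟩ : ∃ k ≤ m, i = nb + 1 + k := ⟨i - (nb + 1), by omega, by omega⟩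
    rw [hC k hk]
    refine (length_copyStrF_le _ _ _ m (fun s hs => (hss s hs).2)).trans ?_
    simp only [hssX, List.length_map]
    nlinarith
  rcases Nat.lt_or_ge i (nb + m + 3) with hi3 | hi3
  · rw [show i = nb + m + 2 by omega, hD]
    refine (length_copyStrF_le _ _ _ m (fun s hs => (hss s hs).2)).trans ?_
    simp only [hssX, List.length_map]
    nlinarith
  · rw [show i = nb + m + 3 by omega, hE, length_plainStrF _ _ m (by
      intro s hs; simp only [List.mem_map] at hs; obtain ⟨ρ, -, rfl⟩ := hs; exact hlenC ρ)]
    simp only [List.length_map, List.length_flatMap, List.length_cons, List.length_nil, List.map_const',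
      List.sum_replicate, smul_eq_mul]
    nlinarith

end Cmp

/-! ## The whole search: induction on the number of unassigned variables -/

section Macro

open _root_.Computability

variable (cs : List (List Lit))

/-- The variables occurring in the clause list. [folklore] -/
def vars : Finset ℕ := (cs.flatten.map Prod.fst).toFinset

/-- `ρ` assigns exactly the variables of `D`. [folklore] -/
def SameDom (D : Finset ℕ) (ρ : Assg) : Prop := ∀ i, ρ i = none ↔ i ∉ D

/-- The pivot determined by a domain: the index of the first literal whose variable is not in `D`. [folklore] -/
def pivotOf (D : Finset ℕ) : Option ℕ := (cs.flatten.find? fun l => decide (l.1 ∉ D)).map Prod.fst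

/-- Every total assignment agrees with some partial assignment of the list. [folklore] -/
def Cov (ρs : List Assg) : Prop := ∀ σ : ℕ → Bool, ∃ ρ ∈ ρs, ∀ i v, ρ i = some v → σ i = v

variable {cs}

/-- Under an assignment with domain `D`, the first literal outside `D` is the first unassigned one. [folklore] -/
theorem firstNone_of_sameDom {D : Finset ℕ} {ρ : Assg} (hρ : SameDom D ρ) {x : ℕ} :
    ∀ ls : List Lit, (ls.find? fun l => decide (l.1 ∉ D)).map Prod.fst = some x → FirstNone ρ x ls
  | [], h => by simp at h
  | l :: ls, h => by
    simp only [List.find?_cons] at h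
    unfold FirstNone
    by_cases hl : l.1 ∈ D
    · have h1 : ρ l.1 ≠ none := fun e => (hρ l.1).1 e hl
      obtain ⟨w, hw⟩ := Option.ne_none_iff_exists'.1 h1
      rw [hw]
      simp only [hl, not_true_eq_false, decide_false] at h
      exact firstNone_of_sameDom hρ ls h
    · have h1 : ρ l.1 = none := (hρ l.1).2 hl
      rw [h1]
      simpa [hl] using h

/-- Under an assignment with domain `D`, some literal is unassigned iff some literal lies outside `D`. [folklore] -/
theorem hasNone_of_sameDom {D : Finset ℕ} {ρ : Assg} (hρ : SameDom D ρ) (ls : List Lit) :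
    hasNone ρ ls = ((ls.find? fun l => decide (l.1 ∉ D)).map Prod.fst).isSome := by
  induction ls with
  | nil => simp [hasNone]
  | cons l ls ih =>
    simp only [hasNone_cons, List.find?_cons]
    by_cases hl : l.1 ∈ D
    · have h1 : ρ l.1 ≠ none := fun e => (hρ l.1).1 e hl
      simp [Option.isNone_iff_eq_none, h1, hl, ih]
    · have h1 : ρ l.1 = none := (hρ l.1).2 hl
      simp [h1, hl]

/-- Extending an assignment with domain `D` at `x` gives domain `insert x D`. [folklore] -/
theorem sameDom_upd {D : Finset ℕ} {ρ : Assg} (hρ : SameDom D ρ) (x : ℕ) (v : Bool) :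
    SameDom (insert x D) (upd ρ x v) := by
  intro i
  by_cases hi : i = x
  · subst hi; simp [upd]
  · rw [upd, Function.update_of_ne hi, Finset.mem_insert, hρ i]; tauto

/-- The pivot of `D` is an occurring variable outside `D`. [folklore] -/
theorem pivotOf_mem {D : Finset ℕ} {x : ℕ} (h : pivotOf cs D = some x) : x ∈ vars cs ∧ x ∉ D := by
  simp only [pivotOf, Option.map_eq_some_iff] at h
  obtain ⟨l, hl, rfl⟩ := h
  have h1 := List.find?_some hl
  have h2 := List.mem_of_find?_eq_some hl
  simp only [decide_eq_true_eq] at h1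
  refine ⟨?_, h1⟩
  simp only [vars, List.mem_toFinset, List.mem_map]
  exact ⟨l, h2, rfl⟩

/-- There is no pivot iff all occurring variables are in `D`. [folklore] -/
theorem pivotOf_eq_none_iff {D : Finset ℕ} : pivotOf cs D = none ↔ vars cs ⊆ D := by
  simp only [pivotOf, Option.map_eq_none_iff, List.find?_eq_none, decide_eq_true_eq, not_not, vars,
    Finset.subset_iff, List.mem_toFinset, List.mem_map]
  constructor
  · rintro h i ⟨l, hl, rfl⟩; exact h l hl
  · intro h l hl; exact h ⟨l, hl, rfl⟩

/-- Removing the pivot decreases the number of unassigned occurring variables by one. [folklore] -/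
theorem card_vars_sdiff_insert {D : Finset ℕ} {x : ℕ} (hx : x ∈ vars cs ∧ x ∉ D) :
    (vars cs \ insert x D).card + 1 = (vars cs \ D).card := by
  have : vars cs \ insert x D = (vars cs \ D).erase x := by
    ext i; simp only [Finset.mem_sdiff, Finset.mem_insert, not_or, Finset.mem_erase]; tauto
  rw [this, Finset.card_erase_add_one]
  simp [hx.1, hx.2]

/-- An occurring variable occurs in some literal. [folklore] -/
theorem exists_mem_flatten_of_mem_vars {x : ℕ} (hx : x ∈ vars cs) : ∃ pol, (x, pol) ∈ cs.flatten := by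
  simp only [vars, List.mem_toFinset, List.mem_map] at hx
  obtain ⟨⟨i, pol⟩, h, rfl⟩ := hx
  exact ⟨pol, h⟩

/-- The code of an occurring variable, plus two, fits in `litsLen`. [folklore] -/
theorem length_encodeNat_le_litsLen {l : Lit} (hl : l ∈ cs.flatten) : (encodeNat l.1).length + 2 ≤ litsLen cs := by
  simp only [List.mem_flatten] at hl
  obtain ⟨cl, hcl, hl⟩ := hl
  unfold litsLen
  have h1 : (encodeNat l.1).length + 2 ≤ (cl.map fun l => (encodeNat l.1).length + 2).sum :=
    List.le_sum_of_mem (List.mem_map.2 ⟨l, hl, rfl⟩)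
  have h2 : 1 + (cl.map fun l => (encodeNat l.1).length + 2).sum ≤
      (cs.map fun cl => 1 + (cl.map fun l => (encodeNat l.1).length + 2).sum).sum :=
    List.le_sum_of_mem (List.mem_map.2 ⟨cl, hcl, rfl⟩)
  omega

/-- Splitting every assignment of a covering list at `x` gives a covering list. [folklore] -/
theorem cov_flatMap_upd {ρs : List Assg} (h : Cov ρs) (x : ℕ) :
    Cov (ρs.flatMap fun ρ => [upd ρ x false, upd ρ x true]) := by
  intro σ
  obtain ⟨ρ, hρ, hag⟩ := h σ
  refine ⟨upd ρ x (σ x), List.mem_flatMap.2 ⟨ρ, hρ, by cases σ x <;> simp⟩, fun i v hv => ?_⟩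
  by_cases hi : i = x
  · subst hi; simp [upd] at hv; exact hv
  · rw [upd, Function.update_of_ne hi] at hv; exact hag i v hv

/-- **The whole search from a `cmp` layout with `d ≥ 1` unassigned variables.** [folklore] -/
theorem search (d : ℕ) : ∀ (D : Finset ℕ) (ρs : List Assg), ρs ≠ [] → (∀ ρ ∈ ρs, SameDom D ρ) →
    (vars cs \ D).card = d → 0 < d →
    ∃ R ≤ d * (2 * litsLen cs + 3), ∃ ρsF : List Assg,
      F^[R] (plainStrF .cmp (ρs.map fun ρ => bodyStr (canon ρ cs))) =
        plainStrF .done (ρsF.map fun ρ => bodyStr (canon ρ cs)) ∧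
      ρsF.length = 2 ^ d * ρs.length ∧
      (∀ ρ ∈ ρsF, ∀ l ∈ cs.flatten, ρ l.1 ≠ none) ∧
      (Cov ρs → Cov ρsF) ∧
      ∀ i ≤ R, (F^[i] (plainStrF .cmp (ρs.map fun ρ => bodyStr (canon ρ cs)))).length ≤
        2 + 2 ^ d * ρs.length * (3 * litsLen cs + 4) := by
  induction d with
  | zero => intro _ _ _ _ _ h; exact absurd h (lt_irrefl 0)
  | succ d ih =>
    intro D ρs hne hD hcard _
    -- the pivot
    obtain ⟨x, hx⟩ : ∃ x, pivotOf cs D = some x := by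
      cases hp : pivotOf cs D with
      | some x => exact ⟨x, rfl⟩
      | none =>
        rw [pivotOf_eq_none_iff, ← Finset.sdiff_eq_empty_iff_subset] at hp
        rw [hp, Finset.card_empty] at hcard; exact absurd hcard (by omega)
    have hxm := pivotOf_mem hx
    have hcard' : (vars cs \ insert x D).card = d := by
      have := card_vars_sdiff_insert hxm; omega
    have hnb : (encodeNat x).length + litsLen cs + 3 ≤ 2 * litsLen cs + 3 := by
      obtain ⟨pol, hl⟩ := exists_mem_flatten_of_mem_vars hxm.1
      have := length_encodeNat_le_litsLen hl
      simp only at this; omega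
    set hN := (pivotOf cs (insert x D)).isSome with hhN
    have h1 : ∀ ρ ∈ ρs, FirstNone ρ x cs.flatten ∧ hasNone ρ cs.flatten = true := fun ρ hρ =>
      ⟨firstNone_of_sameDom (hD ρ hρ) cs.flatten hx, by
        rw [hasNone_of_sameDom (hD ρ hρ)]; simp only [pivotOf] at hx; rw [hx]; rfl⟩
    have h2 : ∀ ρ ∈ ρs, ∀ v, hasNone (upd ρ x v) cs.flatten = hN := fun ρ hρ v => by
      rw [hasNone_of_sameDom (sameDom_upd (hD ρ hρ) x v), hhN, pivotOf]
    obtain ⟨hE, hlen⟩ := cycle x cs ρs hne hN h1 h2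
    set R₁ := (encodeNat x).length + litsLen cs + 3 with hR₁
    set ρs' := ρs.flatMap fun ρ => [upd ρ x false, upd ρ x true] with hρs'
    have hne' : ρs' ≠ [] := by
      cases ρs with
      | nil => exact absurd rfl hne
      | cons ρ _ => simp [hρs']
    have hlen' : ρs'.length = 2 * ρs.length := by
      simp [hρs', List.length_flatMap, List.map_const', List.sum_replicate, mul_comm]
    have hD' : ∀ ρ ∈ ρs', SameDom (insert x D) ρ := by
      intro ρ hρ
      simp only [hρs', List.mem_flatMap, List.mem_cons, List.not_mem_nil, or_false] at hρ
      obtain ⟨ρ₀, hρ₀, rfl | rfl⟩ := hρ <;> exact sameDom_upd (hD ρ₀ hρ₀) x _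
    rcases Nat.eq_zero_or_pos d with hd0 | hdpos
    · -- last cycle: mode `done`
      subst hd0
      have hNf : hN = false := by
        rw [hhN, Option.isSome_eq_false_iff, Option.isNone_iff_eq_none, pivotOf_eq_none_iff,
          ← Finset.sdiff_eq_empty_iff_subset, ← Finset.card_eq_zero, hcard']
      simp only [hNf, Bool.false_eq_true, ↓reduceIte] at hE
      refine ⟨R₁, by omega, ρs', hE, by rw [hlen']; ring, ?_, fun hc => cov_flatMap_upd hc x, ?_⟩
      · intro ρ hρ l hl
        have hs := hD' ρ hρ
        rw [Ne, hs l.1, not_not]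
        have : vars cs ⊆ insert x D := by
          rw [← Finset.sdiff_eq_empty_iff_subset, ← Finset.card_eq_zero, hcard']
        exact this (by simp only [vars, List.mem_toFinset, List.mem_map]; exact ⟨l, hl, rfl⟩)
      · intro i hi
        exact (hlen i hi).trans (le_of_eq (by ring))
    · -- more cycles
      have hNt : hN = true := by
        rw [hhN, Option.isSome_iff_ne_none]
        intro e
        rw [pivotOf_eq_none_iff, ← Finset.sdiff_eq_empty_iff_subset, ← Finset.card_eq_zero, hcard'] at e
        omega
      simp only [hNt, ↓reduceIte] at hE
      obtain ⟨R₂, hR₂, ρsF, hF, hFlen, hFtot, hFcov, hFbd⟩ := ih (insert x D) ρs' hne' hD' hcard' hdpos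
      refine ⟨R₂ + R₁, ?_, ρsF, ?_, ?_, hFtot, fun hc => hFcov (cov_flatMap_upd hc x), ?_⟩
      · have : R₂ + R₁ ≤ d * (2 * litsLen cs + 3) + (2 * litsLen cs + 3) := Nat.add_le_add hR₂ hnb
        linarith
      · rw [Function.iterate_add_apply, hE, hF]
      · rw [hFlen, hlen']; ring
      · intro i hi
        rcases le_or_gt i R₁ with hi1 | hi1
        · refine (hlen i hi1).trans ?_
          have : 2 * ρs.length ≤ 2 ^ (d + 1) * ρs.length :=
            Nat.mul_le_mul_right _ (by
              calc 2 = 2 ^ 1 := by norm_num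
                _ ≤ 2 ^ (d + 1) := Nat.pow_le_pow_right (by norm_num) (by omega))
          nlinarith
        · obtain ⟨i', rfl⟩ : ∃ i', i = i' + R₁ := ⟨i - R₁, by omega⟩
          rw [Function.iterate_add_apply, hE]
          refine (hFbd i' (by omega)).trans ?_
          rw [hlen', pow_succ]
          nlinarith

end Macro

end Canonical

end Literature.Computability.FineGrained.ExhSat
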